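import Literature.Computability.MetaComplexity.BoundedArithQueries
import HarnessLib

/-!
# Query-presentable functions in models of `T₂ⁱ`, part 2: limited iteration and witness search

Trunk: CplxMeta (G14), topic `Literature/Computability/MetaComplexity` (continuation of
`BoundedArithQueries.lean`).  In a model `M ⊨ BASIC + Σᵇ₁-IND + Σᵇₖ₊₁-IND` we prove two further
closure properties of the query-presentable (`Qₖ₊₁`-definable) functions needed for
the universal conservative extension of `T₂ᵏ⁺¹` (Buss 1990, §3):

* **limited iteration with history** (Buss 1990, Thm. 11(b)): for a query-presentable
  `G(x̄, j, u)` and term functions `R, s`, the function `histFn G R s (x̄, u₀)` coding the sequence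
  `u₀, u₁, …, u_ℓ` (`ℓ = |s x̄|`, `u_{j+1} = min (G(x̄, j, u_j)) (R x̄)`) is query-presentable and
  satisfies the recursion equations (`IsQFn.histFn`, `seqEl_histFn_zero`, `seqEl_histFn_succ`);
  the answer code of the iteration is the concatenation of the answer codes of the `ℓ` steps,
  the state before each step being recomputed from the earlier blocks by a `Σᵇₖ₊₁`-definable
  iteration (`BoundedArithSequences`, part `BoundedArithIterate`);
* consequences: comprehension of a query-presentable function along a length (`collectFn`),
  and the least zero below a length (`lsearchFn`): Buss 1990, §4, proof of Thm. 17, third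
  subcase (p. 20: a sharply bounded `μ`-operator is `Qᵢ`-defined "by limited iteration and
  Theorem 11"; cf. Thm. 12 for the bounded case).

The least witness below an *arbitrary* bound (Buss 1990, Thm. 12 proper, by binary search) is
deferred to part 3 (`BoundedArithQueriesMu.lean`, `IsQFn.muFn`).

## References

* S. R. Buss, *Axiomatizations and conservation results for fragments of bounded arithmetic*,
  Contemp. Math. 106, AMS 1990: §3, Thm. 11(b); §4, proof of Thm. 17 (p. 20); Thm. 12 is the
  target of part 3.
* S. R. Buss, *Bounded Arithmetic*, Bibliopolis 1986, §2.6 (limited iteration).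

## Design choices (deltas from the printed definitions, recorded at the reviewer's request)

* Buss's `Qᵢ`-definitions (Buss 1990, p. 11) have a `Σᵇ₁`-defined (polynomial time) output
  function `f*`; `QPres` (part 1) allows a `Σᵇₖ₊₁`-definable `OUT`.  Extensionally, in a model of
  `Σᵇₖ₊₁-IND`, this is the same class of functions (a `Σᵇₖ₊₁`-definable function is computed by a
  binary search with `Σᵇₖ₊₁` queries, `IsQFn.muFn` of part 3, followed by a projection), but the
  definition as written is the broader one; all closure properties are proved for it.
* Bit orientation is the mirror image of Buss's `Bit(j, w) = 1 ↔ U(LSP(w, j), j)`: there query `j`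
  reads the *lower* bits of `w`, here query `p` reads the bits *above* `p` (the convention of
  `IsCanonAtC` in `BoundedArithSequences`).  Accordingly `comp₁` (part 1) puts the inner
  function's block on top, and `histFn` puts step `0` in the top block and step `ℓ - 1` in the
  bottom block, whereas Buss's proofs of Thm. 11 concatenate in the opposite order.
* `histFn` truncates the iterated values at `R x̄` (`min`), so that a value bound — hence a digit
  width — is available for the code; Buss's Thm. 11(b) has the bound `t(y, x̄)` built into the
  limited iteration scheme in the same way.  Two further deltas from Thm. 11(b) as printed:
  there the iteration runs along the *notation* of `y` (`f(y, x̄) = min{h(y, f(⌊y/2⌋, x̄), x̄),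
  t(y, x̄)}`, with a `y`-dependent bound) and returns the final value only; `histFn` iterates on a
  step index `j < |s x̄|` with the `y`-independent bound `R x̄` and returns the whole history (the
  final-value / notation form is recovered by decoding the last digit and re-indexing, which is
  all the consumers need).
-/

namespace Literature.Computability.MetaComplexity

namespace BASICModel

open FirstOrder FirstOrder.Language

variable {M : Type} [Language.boundedArith.Structure M] [hB : M ⊨ BASIC]
  [hI : M ⊨ INDScheme (sigmabFormulas 1)]

/-! ## Definable functions of the query context `(x̄, w, p)` -/

section QFn

variable {k n : ℕ}

/-- Uniform `Σᵇₖ₊₁`-definability of a function `Φ x̄ w p` of the query context. [folklore] -/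
def IsSigmabQFn (k : ℕ) (Φ : (Fin n → M) → M → M → M) : Prop :=
  IsSigmabFn (k + 1) fun u : Fin (n + 2) → M =>
    Φ (Fin.init (Fin.init u)) (u (Fin.last n).castSucc) (u (Fin.last (n + 1)))

omit hB hI in
/-- An output function, as a function of the query context (ignoring `p`). [folklore] -/
theorem IsSigmabOut.isSigmabQFn {O : (Fin n → M) → M → M} (hO : IsSigmabOut k O) :
    IsSigmabQFn k fun x w _ => O x w := hO.lift

omit hI in
/-- A term function of `(x̄, w, p)` is a definable function of the query context. [folklore] -/
theorem IsSigmabQFn.of_isTermFn {Φ : (Fin n → M) → M → M → M}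
    (h : IsTermFn fun u : Fin (n + 2) → M =>
      Φ (Fin.init (Fin.init u)) (u (Fin.last n).castSucc) (u (Fin.last (n + 1)))) :
    IsSigmabQFn k Φ := isSigmabFn_of_isTermFn h _

omit hI in
/-- The position is a definable function of the query context. [folklore] -/
theorem IsSigmabQFn.pos : IsSigmabQFn k fun (_ : Fin n → M) (_ p : M) => p :=
  IsSigmabQFn.of_isTermFn (IsTermFn.proj (Fin.last (n + 1)))

omit hI in
/-- The code is a definable function of the query context. [folklore] -/
theorem IsSigmabQFn.code : IsSigmabQFn k fun (_ : Fin n → M) (w _ : M) => w :=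
  IsSigmabQFn.of_isTermFn (IsTermFn.proj (Fin.last n).castSucc)

omit hI in
/-- A term function of the arguments is a definable function of the query context. [folklore] -/
theorem IsSigmabQFn.args {T : (Fin n → M) → M} (hT : IsTermFn T) :
    IsSigmabQFn k fun (x : Fin n → M) (_ _ : M) => T x :=
  IsSigmabQFn.of_isTermFn (isTermFn_init_init hT)

/-- Closure of definable functions of the query context under binary `Σᵇₖ₊₁`-definable
operations. [folklore] -/
theorem IsSigmabQFn.map₂ {f : M → M → M}
    (hf : IsSigmabFn (k + 1) fun w : Fin 2 → M => f (w 0) (w 1)) {Φ Ψ : (Fin n → M) → M → M → M}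
    (hΦ : IsSigmabQFn k Φ) (hΨ : IsSigmabQFn k Ψ) : IsSigmabQFn k fun x w p => f (Φ x w p) (Ψ x w p) :=
  hf.comp₂FnFn' hΦ hΨ

/-- Closure under unary `Σᵇₖ₊₁`-definable operations. [folklore] -/
theorem IsSigmabQFn.map₁ {f : M → M} (hf : IsSigmabFn (k + 1) fun v : Fin 1 → M => f (v 0))
    {Φ : (Fin n → M) → M → M → M} (hΦ : IsSigmabQFn k Φ) : IsSigmabQFn k fun x w p => f (Φ x w p) :=
  hf.comp₁Fn' hΦ

/-- `Φ mod 2^{B}` (exponents under `|A|`), all definable functions of the query context. [folklore] -/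
theorem IsSigmabQFn.modPow2B {A B W : (Fin n → M) → M → M → M} (hA : IsSigmabQFn k A)
    (hB : IsSigmabQFn k B) (hW : IsSigmabQFn k W) :
    IsSigmabQFn k fun x w p => W x w p % pow2B (A x w p) (B x w p) :=
  (isSigmabFn_mod' k).comp₂FnFn' hW ((isSigmabFn_pow2B' k).comp₂FnFn' hA hB)

/-- `⌊Φ / 2^{B}⌋` (exponents under `|A|`), all definable functions of the query context. [folklore] -/
theorem IsSigmabQFn.divPow2B {A B W : (Fin n → M) → M → M → M} (hA : IsSigmabQFn k A)
    (hB : IsSigmabQFn k B) (hW : IsSigmabQFn k W) :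
    IsSigmabQFn k fun x w p => W x w p / pow2B (A x w p) (B x w p) :=
  ((isSigmabFn_div 1).mono (Nat.le_add_left 1 k)).comp₂FnFn' hW
    ((isSigmabFn_pow2B' k).comp₂FnFn' hA hB)

/-- Division, definable functions of the query context. [folklore] -/
theorem IsSigmabQFn.div {Φ Ψ : (Fin n → M) → M → M → M} (hΦ : IsSigmabQFn k Φ)
    (hΨ : IsSigmabQFn k Ψ) : IsSigmabQFn k fun x w p => Φ x w p / Ψ x w p :=
  ((isSigmabFn_div 1).mono (Nat.le_add_left 1 k)).comp₂FnFn' hΦ hΨ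

/-- Remainder, definable functions of the query context. [folklore] -/
theorem IsSigmabQFn.mod {Φ Ψ : (Fin n → M) → M → M → M} (hΦ : IsSigmabQFn k Φ)
    (hΨ : IsSigmabQFn k Ψ) : IsSigmabQFn k fun x w p => Φ x w p % Ψ x w p :=
  (isSigmabFn_mod' k).comp₂FnFn' hΦ hΨ

/-- Truncated subtraction, definable functions of the query context. [folklore] -/
theorem IsSigmabQFn.sub {Φ Ψ : (Fin n → M) → M → M → M} (hΦ : IsSigmabQFn k Φ)
    (hΨ : IsSigmabQFn k Ψ) : IsSigmabQFn k fun x w p => Φ x w p - Ψ x w p :=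
  (isSigmabFn_sub (IsTermFn.proj 0) (IsTermFn.proj 1) _).comp₂FnFn' hΦ hΨ

/-- Product, definable functions of the query context. [folklore] -/
theorem IsSigmabQFn.mul {Φ Ψ : (Fin n → M) → M → M → M} (hΦ : IsSigmabQFn k Φ)
    (hΨ : IsSigmabQFn k Ψ) : IsSigmabQFn k fun x w p => Φ x w p * Ψ x w p :=
  (isSigmabFn_mul _).comp₂FnFn' hΦ hΨ

omit hB hI in
/-- **General substitution in a query family of arity `n + 2`**: the last two arguments, the code
and the position are replaced by definable functions of the query context:
`(x̄, w, p) ↦ Q (x̄, J, U) C D`. [folklore] -/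
theorem IsSigmabQuery.subst₂ {Q : (Fin (n + 2) → M) → M → M → Prop} (hQ : IsSigmabQuery k Q)
    {J U C D : (Fin n → M) → M → M → M} (hJ : IsSigmabQFn k J) (hU : IsSigmabQFn k U)
    (hC : IsSigmabQFn k C) (hD : IsSigmabQFn k D) :
    IsSigmabQuery k fun x w p =>
      Q (Fin.snoc (Fin.snoc x (J x w p)) (U x w p)) (C x w p) (D x w p) := by
  -- context `(x̄, w, p, j, u, c, d)` : `Fin (n + 6)`;  `R U := Q (x̄, j, u) c d`
  let x4 : Fin n → Fin (n + 6) := fun i => i.castSucc.castSucc.castSucc.castSucc.castSucc.castSucc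
  let cj : Fin (n + 6) := (Fin.last (n + 2)).castSucc.castSucc.castSucc
  let cu : Fin (n + 6) := (Fin.last (n + 3)).castSucc.castSucc
  let cc : Fin (n + 6) := (Fin.last (n + 4)).castSucc
  let cd : Fin (n + 6) := Fin.last (n + 5)
  let e : Fin (n + 4) → Fin (n + 6) :=
    Fin.snoc (α := fun _ => Fin (n + 6))
      (Fin.snoc (α := fun _ => Fin (n + 6))
        (Fin.snoc (α := fun _ => Fin (n + 6))
          (Fin.snoc (α := fun _ => Fin (n + 6)) x4 cj) cu) cc) cd
  have hR : IsSigmabDef (k + 1) fun V : Fin (n + 6) → M =>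
      Q (Fin.snoc (Fin.snoc (V ∘ x4) (V cj)) (V cu)) (V cc) (V cd) := by
    refine (IsSigmabDef.comp hQ e).of_iff fun V => ?_
    have e1 : Fin.init (Fin.init (V ∘ e)) = Fin.snoc (Fin.snoc (V ∘ x4) (V cj)) (V cu) := by
      funext i
      cases i using Fin.lastCases with
      | last => simp [e, Fin.init]
      | cast i =>
        cases i using Fin.lastCases with
        | last => simp [e, Fin.init]
        | cast i => simp [e, Fin.init, x4]
    have e2 : (V ∘ e) (Fin.last (n + 2)).castSucc = V cc := by simp [e]
    have e3 : (V ∘ e) (Fin.last (n + 3)) = V cd := by simp [e]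
    rw [IsSigmabQuery] at hQ
    simp only [e1, e2, e3]
  -- the substituted functions, in the growing contexts
  have hD' : IsSigmabFn (k + 1) fun V : Fin (n + 5) → M =>
      D (Fin.init (Fin.init (Fin.init (Fin.init (Fin.init V))))) (V (Fin.last n).castSucc.castSucc.castSucc.castSucc)
        (V (Fin.last (n + 1)).castSucc.castSucc.castSucc) :=
    (((IsSigmabFn.comp hD Fin.castSucc).comp Fin.castSucc).comp Fin.castSucc).of_eq fun _ => rfl
  have hC' : IsSigmabFn (k + 1) fun V : Fin (n + 4) → M =>
      C (Fin.init (Fin.init (Fin.init (Fin.init V)))) (V (Fin.last n).castSucc.castSucc.castSucc)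
        (V (Fin.last (n + 1)).castSucc.castSucc) :=
    ((IsSigmabFn.comp hC Fin.castSucc).comp Fin.castSucc).of_eq fun _ => rfl
  have hU' : IsSigmabFn (k + 1) fun V : Fin (n + 3) → M =>
      U (Fin.init (Fin.init (Fin.init V))) (V (Fin.last n).castSucc.castSucc)
        (V (Fin.last (n + 1)).castSucc) :=
    (IsSigmabFn.comp hU Fin.castSucc).of_eq fun _ => rfl
  have h1 := ((hR.snocFn hD').snocFn hC').snocFn hU'
  have h2 := h1.snocFn hJ
  refine h2.of_iff fun u => ?_
  have ex : ∀ (a b c d : M),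
      ((Fin.snoc (Fin.snoc (Fin.snoc (Fin.snoc u a : Fin (n + 3) → M) b : Fin (n + 4) → M) c :
        Fin (n + 5) → M) d : Fin (n + 6) → M) ∘ x4) = Fin.init (Fin.init u) := by
    intro a b c d
    funext i
    simp [x4, Fin.init]
  simp [cj, cu, cc, cd, ex, Fin.init_snoc, Fin.snoc_castSucc, Fin.snoc_last]

/-- **General substitution in an output function of arity `n + 2`**:
`(x̄, w) ↦ OUT (x̄, J, U) C` for output functions `J, U, C`. [folklore] -/
theorem IsSigmabOut.subst₂ {O : (Fin (n + 2) → M) → M → M} (hO : IsSigmabOut k O)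
    {J U C : (Fin n → M) → M → M} (hJ : IsSigmabOut k J) (hU : IsSigmabOut k U)
    (hC : IsSigmabOut k C) :
    IsSigmabOut k fun x w => O (Fin.snoc (Fin.snoc x (J x w)) (U x w)) (C x w) := by
  -- context `(x̄, w, j, u, c)` : `Fin (n + 4)`;  `F V := O (x̄, j, u) c`
  let x3 : Fin n → Fin (n + 4) := fun i => i.castSucc.castSucc.castSucc.castSucc
  let cj : Fin (n + 4) := (Fin.last (n + 1)).castSucc.castSucc
  let cu : Fin (n + 4) := (Fin.last (n + 2)).castSucc
  let cc : Fin (n + 4) := Fin.last (n + 3)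
  let e : Fin (n + 3) → Fin (n + 4) :=
    Fin.snoc (α := fun _ => Fin (n + 4))
      (Fin.snoc (α := fun _ => Fin (n + 4)) (Fin.snoc (α := fun _ => Fin (n + 4)) x3 cj) cu) cc
  have hF : IsSigmabFn (k + 1) fun V : Fin (n + 4) → M =>
      O (Fin.snoc (Fin.snoc (V ∘ x3) (V cj)) (V cu)) (V cc) := by
    refine (IsSigmabFn.comp hO e).of_eq fun V => ?_
    have e1 : Fin.init (V ∘ e) = Fin.snoc (Fin.snoc (V ∘ x3) (V cj)) (V cu) := by
      funext i
      cases i using Fin.lastCases with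
      | last => simp [e, Fin.init]
      | cast i =>
        cases i using Fin.lastCases with
        | last => simp [e, Fin.init]
        | cast i => simp [e, Fin.init, x3]
    have e2 : (V ∘ e) (Fin.last (n + 2)) = V cc := by simp [e]
    rw [IsSigmabOut] at hO
    simp only [e1, e2]
  have hC' : IsSigmabFn (k + 1) fun V : Fin (n + 3) → M =>
      C (Fin.init (Fin.init (Fin.init V))) (V (Fin.last n).castSucc.castSucc) :=
    ((IsSigmabFn.comp hC Fin.castSucc).comp Fin.castSucc).of_eq fun _ => rfl
  have hU' : IsSigmabFn (k + 1) fun V : Fin (n + 2) → M =>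
      U (Fin.init (Fin.init V)) (V (Fin.last n).castSucc) :=
    (IsSigmabFn.comp hU Fin.castSucc).of_eq fun _ => rfl
  have hJ' : IsSigmabFn (k + 1) fun V : Fin (n + 1) → M => J (Fin.init V) (V (Fin.last n)) := hJ
  have h1 := ((hF.snocFn' hC').snocFn' hU').snocFn' hJ'
  refine h1.of_eq fun u => ?_
  have ex : ∀ (a b c : M),
      ((Fin.snoc (Fin.snoc (Fin.snoc u a : Fin (n + 2) → M) b : Fin (n + 3) → M) c :
        Fin (n + 4) → M) ∘ x3) = Fin.init u := by
    intro a b c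
    funext i
    simp [x3, Fin.init]
  simp [cj, cu, cc, ex, Fin.init_snoc, Fin.snoc_castSucc, Fin.snoc_last]

omit hI in
/-- A comparison `D x̄ w p < F x̄ w p` of definable functions of the query context is a
uniformly definable query family. [folklore] -/
theorem IsSigmabQuery.lt {D F : (Fin n → M) → M → M → M} (hD : IsSigmabQFn k D)
    (hF : IsSigmabQFn k F) : IsSigmabQuery k fun x w p => D x w p < F x w p := by
  have h := IsSigmabFn.isDeltabDef_le hF hD
  refine (h.not.1).of_iff fun u => ?_
  simp [mLe_iff, not_le]

end QFn

/-! ## Generic `Σᵇ`-arithmetic of definable functions; `min`; `|a| ≤ a` -/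

section Arith

variable {i m : ℕ} {A B : (Fin m → M) → M}

/-- Difference of `Σᵇᵢ₊₁`-definable functions. [folklore] -/
theorem _root_.Literature.Computability.MetaComplexity.IsSigmabFn.sub₂ (hA : IsSigmabFn (i + 1) A)
    (hB : IsSigmabFn (i + 1) B) : IsSigmabFn (i + 1) fun v => A v - B v :=
  (isSigmabFn_sub (IsTermFn.proj 0) (IsTermFn.proj 1) _).comp₂FnFn' hA hB

/-- Quotient of `Σᵇᵢ₊₁`-definable functions. [folklore] -/
theorem _root_.Literature.Computability.MetaComplexity.IsSigmabFn.div₂ (hA : IsSigmabFn (i + 1) A)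
    (hB : IsSigmabFn (i + 1) B) : IsSigmabFn (i + 1) fun v => A v / B v :=
  ((isSigmabFn_div 1).mono (Nat.le_add_left 1 i)).comp₂FnFn' hA hB

/-- Remainder of `Σᵇᵢ₊₁`-definable functions. [folklore] -/
theorem _root_.Literature.Computability.MetaComplexity.IsSigmabFn.mod₂ (hA : IsSigmabFn (i + 1) A)
    (hB : IsSigmabFn (i + 1) B) : IsSigmabFn (i + 1) fun v => A v % B v :=
  (isSigmabFn_mod' i).comp₂FnFn' hA hB

/-- `pow2B` of `Σᵇᵢ₊₁`-definable functions. [folklore] -/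
theorem _root_.Literature.Computability.MetaComplexity.IsSigmabFn.pow2B₂ (hA : IsSigmabFn (i + 1) A)
    (hB : IsSigmabFn (i + 1) B) : IsSigmabFn (i + 1) fun v => pow2B (A v) (B v) :=
  (isSigmabFn_pow2B' i).comp₂FnFn' hA hB

/-- Product of `Σᵇᵢ₊₁`-definable functions. [folklore] -/
theorem _root_.Literature.Computability.MetaComplexity.IsSigmabFn.mul₂ (hA : IsSigmabFn (i + 1) A)
    (hB : IsSigmabFn (i + 1) B) : IsSigmabFn (i + 1) fun v => A v * B v :=
  (isSigmabFn_mul _).comp₂FnFn' hA hB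

/-- Sum of `Σᵇᵢ₊₁`-definable functions. [folklore] -/
theorem _root_.Literature.Computability.MetaComplexity.IsSigmabFn.add₂ (hA : IsSigmabFn (i + 1) A)
    (hB : IsSigmabFn (i + 1) B) : IsSigmabFn (i + 1) fun v => A v + B v :=
  (isSigmabFn_add _).comp₂FnFn' hA hB

omit hI in
/-- The graph of `min` is open-definable: `c = min a b ↔ (a ≤ b ∧ c = a) ∨ (b < a ∧ c = b)`.
[folklore] -/
theorem isQFDef_min_graph : IsQFDef fun w : Fin 3 → M => w 2 = min (w 0) (w 1) := by
  refine (((IsQFDef.le (IsTermFn.proj 0) (IsTermFn.proj 1)).and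
    (IsQFDef.eq (IsTermFn.proj 2) (IsTermFn.proj 0))).or
    ((isQFDef_lt (IsTermFn.proj 1) (IsTermFn.proj 0)).and
      (IsQFDef.eq (IsTermFn.proj 2) (IsTermFn.proj 1)))).of_iff fun w => ?_
  simp only [mLe_iff]
  rcases le_or_gt (w 0) (w 1) with h | h
  · simp [h, not_lt.2 h]
  · simp [min_eq_right h.le, h, not_le.2 h]

omit hI in
/-- `min` is a `Σᵇᵢ`-definable binary function (open graph, bounded by the first argument).
[folklore] -/
theorem isSigmabFn_min (i : ℕ) : IsSigmabFn i fun w : Fin 2 → M => min (w 0) (w 1) := by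
  refine ⟨(isQFDef_min_graph.isSigmabDef i).of_iff fun v => ?_, fun w => w 0, IsTermFn.proj 0,
    fun w => by simp⟩
  simp [graphPred, Fin.init]

/-- Minimum of `Σᵇᵢ₊₁`-definable functions. [folklore] -/
theorem _root_.Literature.Computability.MetaComplexity.IsSigmabFn.min₂ (hA : IsSigmabFn (i + 1) A)
    (hB : IsSigmabFn (i + 1) B) : IsSigmabFn (i + 1) fun v => min (A v) (B v) :=
  (isSigmabFn_min _).comp₂FnFn' hA hB

/-- **`|a| ≤ a`** in a model of `T₂¹` (open induction: `|a + 1| ≤ |a| + 1`). [folklore] -/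
theorem mLen_le_self (a : M) : mLen a ≤ a := by
  refine ind (P := fun a => mLen a ≤ a) ?_ (by simp) (fun a ih => ?_) a
  · exact ((IsQFDef.le (IsTermFn.proj 0).len (IsTermFn.proj 0)).isSigmabDef 1).of_iff fun v => by
      simp [mLe_iff]
  · exact (mLen_add_one_le a).trans (by gcongr)

omit hI in
/-- `a < b` gives `1 ≤ b`. [folklore] -/
theorem one_le_of_lt {a b : M} (h : a < b) : 1 ≤ b :=
  (one_le_iff_ne_zero' _).2 ((pos_iff_ne_zero' _).1 (lt_of_le_of_lt bot_le h))

variable {F : (Fin (m + 2) → M) → M} {init r sN : (Fin m → M) → M}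

/-- **Uniqueness of computations**: two codes of the computation of the same length coincide
(`l ≤ |s x̄|`), by uniqueness of digits. [cite: Buss1986, §2.6] -/
theorem IsItSeq.unique {xs : Fin m → M} {l H H' : M} (hl : l ≤ mLen (sN xs))
    (h : IsItSeq F init r sN xs l H) (h' : IsItSeq F init r sN xs l H') : H = H' := by
  have hL : (l + 1) * itWidth r xs ≤ mLen (itBound r sN xs) := itExp_le (by gcongr)
  exact ext_of_seqEl hL h.1 h'.1 fun p hp => h.seqEl_eq h' hl ((lt_add_one_iff' p l).1 hp)

end Arith

/-! ## Limited iteration with history (Buss 1990, Thm. 11(b)) -/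

section Hist

variable {k n : ℕ}

/-! ### The iteration data, semantically -/

/-- The value bound of the iteration at the arguments `(x̄, u₀)`: `u₀ + R x̄`. [folklore] -/
def histR (R : (Fin n → M) → M) (xs : Fin (n + 1) → M) : M := xs (Fin.last n) + R (Fin.init xs)

/-- The number of steps `ℓ = |s x̄|`, as a function of `(x̄, u₀)`. [folklore] -/
def histLen (s : (Fin n → M) → M) (xs : Fin (n + 1) → M) : M := mLen (s (Fin.init xs))

/-- The step of the truncated iteration of `G`: `(x̄, u₀; j, c) ↦ min (G(x̄, j, c)) (R x̄)`
(on the context `((x̄, u₀), j, c)`). [folklore] -/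
noncomputable def histStep (G : (Fin (n + 2) → M) → M) (R : (Fin n → M) → M) (V : Fin (n + 1 + 2) → M) : M :=
  min (G (Fin.snoc (Fin.snoc (Fin.init (Fin.init (Fin.init V))) (V (Fin.last (n + 1)).castSucc))
    (V (Fin.last (n + 2))))) (R (Fin.init (Fin.init (Fin.init V))))

/-- The initial value `u₀` of the iteration, read off `(x̄, u₀)`. [folklore] -/
def histInit (xs : Fin (n + 1) → M) : M := xs (Fin.last n)

/-- The length parameter `s x̄` of the iteration, read off `(x̄, u₀)`. [folklore] -/
def histS (s : (Fin n → M) → M) (xs : Fin (n + 1) → M) : M := s (Fin.init xs)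

open scoped Classical in
/-- The code of the full-length computation of a step function `F` on `((x̄, u₀), j, c)` from `u₀`
(`0` if there is none). [folklore] -/
noncomputable def histCode (F : (Fin (n + 1 + 2) → M) → M) (R s : (Fin n → M) → M)
    (xs : Fin (n + 1) → M) : M :=
  if h : ∃ H, IsItSeq F histInit (histR R) (histS s) xs (histLen s xs) H then
    Classical.choose h else 0

/-- **`histFn G R s (x̄, u₀)`**: the code of the sequence `u₀, u₁, …, u_ℓ` with `ℓ = |s x̄|` and
`u_{j+1} = min (G(x̄, j, u_j)) (R x̄)`, digits of width `|u₀ + R x̄|` under the length bound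
`itBound` (Buss 1990, Thm. 11(b): limited iteration; Buss 1986, §2.6), if such a computation
exists in `M` (`0` otherwise). [cite: BussContempMath1990, Thm. 11(b)] -/
noncomputable def histFn (G : (Fin (n + 2) → M) → M) (R s : (Fin n → M) → M) :
    (Fin (n + 1) → M) → M :=
  histCode (histStep G R) R s

namespace QPres

variable (PG : QPres M k (n + 2)) (R s : (Fin n → M) → M)

/-! ### The presentation of the iteration -/

/-- The dominating argument `(x̄, s x̄, u₀ + R x̄)` of all `(x̄, j, u_j)`. [folklore] -/
def hPad (xs : Fin (n + 1) → M) : Fin (n + 2) → M :=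
  Fin.snoc (Fin.snoc (Fin.init xs) (s (Fin.init xs))) (histR R xs)

/-- Padded number of queries of one step: `L_G` at the dominating argument. [folklore] -/
noncomputable def hΛ (xs : Fin (n + 1) → M) : M := PG.L (hPad R s xs)

/-- Length bound of one step at the dominating argument. [folklore] -/
noncomputable def hSG (xs : Fin (n + 1) → M) : M := PG.S (hPad R s xs)

/-- Total number of queries: `ℓ · hΛ`. [folklore] -/
noncomputable def hL (xs : Fin (n + 1) → M) : M := histLen s xs * hΛ PG R s xs

/-- Length bound of the iteration: `s x̄ # hSG`. [folklore] -/
noncomputable def hS (xs : Fin (n + 1) → M) : M := mSmash (s (Fin.init xs)) (hSG PG R s xs)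

/-- Block number `m` (from the bottom) of a code (truncated to its `hL` meaningful bits): the
answers of step `ℓ - 1 - m`. [folklore] -/
noncomputable def hBlk (xs : Fin (n + 1) → M) (w m : M) : M :=
  w % pow2B (hS PG R s xs) (hL PG R s xs) / pow2B (hS PG R s xs) (m * hΛ PG R s xs) %
    pow2B (hS PG R s xs) (hΛ PG R s xs)

/-- The step of the *recomputation* of the states from a code `w`: `((x̄, u₀, w), j, c) ↦
min (OUT_G (x̄, j, c) (block ℓ-1-j of w)) (R x̄)`. [folklore] -/
noncomputable def hF (V : Fin (n + 2 + 2) → M) : M :=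
  min (PG.OUT (Fin.snoc (Fin.snoc (Fin.init (Fin.init (Fin.init (Fin.init V))))
      (V (Fin.last (n + 2)).castSucc)) (V (Fin.last (n + 3))))
    (hBlk PG R s (Fin.init (Fin.init (Fin.init V))) (V (Fin.last (n + 1)).castSucc.castSucc)
      (histLen s (Fin.init (Fin.init (Fin.init V))) - 1 - V (Fin.last (n + 2)).castSucc)))
    (R (Fin.init (Fin.init (Fin.init (Fin.init V)))))

/-- Initial value of the recomputation, read off `(x̄, u₀, w)`. [folklore] -/
def hInit (xsw : Fin (n + 2) → M) : M := xsw (Fin.last n).castSucc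

/-- Value bound of the recomputation, read off `(x̄, u₀, w)`. [folklore] -/
def hr (xsw : Fin (n + 2) → M) : M := histR R (Fin.init xsw)

/-- Length parameter of the recomputation, read off `(x̄, u₀, w)`. [folklore] -/
def hsN (xsw : Fin (n + 2) → M) : M := s (Fin.init (Fin.init xsw))

/-- The state before step `j`, recomputed from the code `w`. [folklore] -/
noncomputable def hU (xs : Fin (n + 1) → M) (w j : M) : M :=
  iter (hF PG R s) hInit (hr R) (hsN s) (Fin.snoc xs w) j

/-- The arguments `(x̄, j, u_j)` of step `j`, the state recomputed from `w`. [folklore] -/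
noncomputable def hArgs (xs : Fin (n + 1) → M) (w j : M) : Fin (n + 2) → M :=
  Fin.snoc (Fin.snoc (Fin.init xs) j) (hU PG R s xs w j)

/-- The queries of the iteration: at position `p` in block `m = p / hΛ` (step `j = ℓ - 1 - m`),
the query `p mod hΛ` of `G` at `(x̄, j, u_j)` (below `L_G` there; `0`-padding above). [folklore] -/
def hQ (xs : Fin (n + 1) → M) (w p : M) : Prop :=
  p % hΛ PG R s xs < PG.L (hArgs PG R s xs w (histLen s xs - 1 - p / hΛ PG R s xs)) ∧
    PG.Q (hArgs PG R s xs w (histLen s xs - 1 - p / hΛ PG R s xs))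
      (hBlk PG R s xs w (p / hΛ PG R s xs)) (p % hΛ PG R s xs)

open scoped Classical in
/-- The output of the iteration: the code of the recomputed states `u₀, …, u_ℓ`. [folklore] -/
noncomputable def hOUT (xs : Fin (n + 1) → M) (w : M) : M :=
  if h : ∃ H, IsItSeq (hF PG R s) hInit (hr R) (hsN s) (Fin.snoc xs w) (histLen s xs) H then
    Classical.choose h else 0

/-! ### Term functions and lengths -/

variable {R s} (hR : IsTermFn R) (hs : IsTermFn s)
include hR in
omit hI in
/-- `histR` is a term function. [folklore] -/
theorem isTermFn_histR : IsTermFn (histR R : (Fin (n + 1) → M) → M) :=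
  (IsTermFn.proj (Fin.last n)).add (isTermFn_init hR)

include hs in
omit hB hI in
/-- `histLen` is a term function. [folklore] -/
theorem isTermFn_histLen : IsTermFn (histLen s : (Fin (n + 1) → M) → M) := (isTermFn_init hs).len

include hR hs in
omit hI in
/-- The coordinates of `hPad` are term functions. [folklore] -/
theorem isTermFn_hPad_apply (j : Fin (n + 2)) : IsTermFn fun xs : Fin (n + 1) → M => hPad R s xs j := by
  cases j using Fin.lastCases with
  | last => simpa [hPad] using isTermFn_histR (n := n) hR
  | cast j =>
    cases j using Fin.lastCases with
    | last => simpa [hPad] using isTermFn_init (n := n) hs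
    | cast j => simpa [hPad, Fin.init] using IsTermFn.proj (m := n + 1) j.castSucc

include hR hs in
/-- `hΛ` is a term function. [folklore] -/
theorem isTermFn_hΛ : IsTermFn (hΛ PG R s) :=
  (PG.isTermFn_L.substAll (isTermFn_hPad_apply hR hs)).of_eq fun _ => rfl

include hR hs in
/-- `hSG` is a term function. [folklore] -/
theorem isTermFn_hSG : IsTermFn (hSG PG R s) :=
  (PG.isTermFn_S.substAll (isTermFn_hPad_apply hR hs)).of_eq fun _ => rfl

include hR hs in
/-- `hL` is a term function. [folklore] -/
theorem isTermFn_hL : IsTermFn (hL PG R s) := (isTermFn_histLen hs).mul (isTermFn_hΛ PG hR hs)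

include hR hs in
/-- `hS` is a term function. [folklore] -/
theorem isTermFn_hS : IsTermFn (hS PG R s) := (isTermFn_init hs).smash (isTermFn_hSG PG hR hs)

/-- `hΛ ≤ |hSG|`. [folklore] -/
theorem hΛ_le (xs : Fin (n + 1) → M) : hΛ PG R s xs ≤ mLen (hSG PG R s xs) := PG.L_le _

/-- `|s x̄| · |hSG| + 1 = |hS|`. [folklore] -/
theorem mLen_hS (xs : Fin (n + 1) → M) :
    mLen (hS PG R s xs) = histLen s xs * mLen (hSG PG R s xs) + 1 := by
  rw [hS, mLen_mSmash, histLen]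

/-- `hL ≤ |hS|`. [folklore] -/
theorem hL_le (xs : Fin (n + 1) → M) : hL PG R s xs ≤ mLen (hS PG R s xs) := by
  rw [mLen_hS, hL]
  exact (mul_le_mul'' le_rfl (hΛ_le PG xs)).trans (le_add_right'' _ _)

/-- `1 ≤ |hS|`. [folklore] -/
theorem one_le_mLen_hS (xs : Fin (n + 1) → M) : 1 ≤ mLen (hS PG R s xs) := by
  rw [mLen_hS]; exact le_add_left'' _ _

/-- `hΛ ≤ |hS|` (when there is at least one step). [folklore] -/
theorem hΛ_le_mLen_hS {xs : Fin (n + 1) → M} (h : 1 ≤ histLen s xs) :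
    hΛ PG R s xs ≤ mLen (hS PG R s xs) := by
  rw [mLen_hS]
  calc hΛ PG R s xs ≤ mLen (hSG PG R s xs) := hΛ_le PG xs
    _ = 1 * mLen (hSG PG R s xs) := (one_mul _).symm
    _ ≤ histLen s xs * mLen (hSG PG R s xs) := mul_le_mul'' h le_rfl
    _ ≤ _ := le_add_right'' _ _

/-- `(m + 1) · hΛ ≤ hL` for a block number `m < ℓ`. [folklore] -/
theorem succ_mul_hΛ_le {xs : Fin (n + 1) → M} {m : M} (hm : m < histLen s xs) :
    (m + 1) * hΛ PG R s xs ≤ hL PG R s xs :=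
  mul_le_mul'' ((add_one_le_iff' _ _).2 hm) le_rfl

/-! ### Definability of the recomputation -/

omit hB hI in
/-- A term function of the first `m` coordinates, in a context with three more. [folklore] -/
theorem _root_.Literature.Computability.MetaComplexity.BASICModel.isTermFn_init3 {m : ℕ}
    {T : (Fin m → M) → M} (hT : IsTermFn T) :
    IsTermFn fun V : Fin (m + 3) → M => T (Fin.init (Fin.init (Fin.init V))) :=
  (((hT.comp Fin.castSucc).comp Fin.castSucc).comp Fin.castSucc).of_eq fun _ => rfl

omit hB hI in
/-- A term function of the first `m` coordinates, in a context with four more. [folklore] -/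
theorem _root_.Literature.Computability.MetaComplexity.BASICModel.isTermFn_init4 {m : ℕ}
    {T : (Fin m → M) → M} (hT : IsTermFn T) :
    IsTermFn fun V : Fin (m + 4) → M => T (Fin.init (Fin.init (Fin.init (Fin.init V)))) :=
  ((((hT.comp Fin.castSucc).comp Fin.castSucc).comp Fin.castSucc).comp Fin.castSucc).of_eq
    fun _ => rfl

include hR hs in
/-- The block read by the recomputation step, `((x̄, u₀), w, j, c) ↦ hBlk (x̄, u₀) w (ℓ - 1 - j)`,
is `Σᵇₖ₊₁`-definable. [folklore] -/
theorem isSigmabFn_hBlk_step : IsSigmabFn (k + 1) fun V : Fin (n + 1 + 3) → M =>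
    hBlk PG R s (Fin.init (Fin.init (Fin.init V))) (V (Fin.last (n + 1)).castSucc.castSucc)
      (histLen s (Fin.init (Fin.init (Fin.init V))) - 1 - V (Fin.last (n + 2)).castSucc) := by
  have hSt : IsSigmabFn (k + 1) fun V : Fin (n + 1 + 3) → M => hS PG R s (Fin.init (Fin.init (Fin.init V))) :=
    isSigmabFn_of_isTermFn (isTermFn_init3 (isTermFn_hS PG hR hs)) _
  have hΛt : IsSigmabFn (k + 1) fun V : Fin (n + 1 + 3) → M => hΛ PG R s (Fin.init (Fin.init (Fin.init V))) :=
    isSigmabFn_of_isTermFn (isTermFn_init3 (isTermFn_hΛ PG hR hs)) _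
  have hLt : IsSigmabFn (k + 1) fun V : Fin (n + 1 + 3) → M => hL PG R s (Fin.init (Fin.init (Fin.init V))) :=
    isSigmabFn_of_isTermFn (isTermFn_init3 (isTermFn_hL PG hR hs)) _
  have hm : IsSigmabFn (k + 1) fun V : Fin (n + 1 + 3) → M =>
      histLen s (Fin.init (Fin.init (Fin.init V))) - 1 - V (Fin.last (n + 2)).castSucc :=
    ((isSigmabFn_of_isTermFn (isTermFn_init3 (isTermFn_histLen hs)) _).sub₂
      (isSigmabFn_of_isTermFn isTermFn_one _)).sub₂
      (isSigmabFn_of_isTermFn (IsTermFn.proj _) _)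
  have hw : IsSigmabFn (k + 1) fun V : Fin (n + 1 + 3) → M => V (Fin.last (n + 1)).castSucc.castSucc :=
    isSigmabFn_of_isTermFn (IsTermFn.proj _) _
  exact ((hw.mod₂ (hSt.pow2B₂ hLt)).div₂ (hSt.pow2B₂ (hm.mul₂ hΛt))).mod₂ (hSt.pow2B₂ hΛt)

include hR hs in
/-- The recomputation step `hF` is `Σᵇₖ₊₁`-definable. [folklore] -/
theorem isSigmabFn_hF : IsSigmabFn (k + 1) (hF PG R s) := by
  -- context `((x̄, u₀), w, j, c, b)` : `Fin (n + 1 + 4)`;  `O V := OUT_G (x̄, j, c) b`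
  let x5 : Fin n → Fin (n + 1 + 4) := fun i => i.castSucc.castSucc.castSucc.castSucc.castSucc
  let cj : Fin (n + 1 + 4) := (Fin.last (n + 2)).castSucc.castSucc
  let cc : Fin (n + 1 + 4) := (Fin.last (n + 3)).castSucc
  let cb : Fin (n + 1 + 4) := Fin.last (n + 4)
  let e : Fin (n + 3) → Fin (n + 1 + 4) :=
    Fin.snoc (α := fun _ => Fin (n + 1 + 4))
      (Fin.snoc (α := fun _ => Fin (n + 1 + 4)) (Fin.snoc (α := fun _ => Fin (n + 1 + 4)) x5 cj) cc) cb
  have hO : IsSigmabFn (k + 1) fun V : Fin (n + 1 + 4) → M =>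
      PG.OUT (Fin.snoc (Fin.snoc (V ∘ x5) (V cj)) (V cc)) (V cb) := by
    refine (IsSigmabFn.comp PG.isSigmabOut e).of_eq fun V => ?_
    have e1 : Fin.init (V ∘ e) = Fin.snoc (Fin.snoc (V ∘ x5) (V cj)) (V cc) := by
      funext i
      cases i using Fin.lastCases with
      | last => simp [e, Fin.init]
      | cast i =>
        cases i using Fin.lastCases with
        | last => simp [e, Fin.init]
        | cast i => simp [e, Fin.init, x5]
    have e2 : (V ∘ e) (Fin.last (n + 2)) = V cb := by simp [e]
    simp only [e1, e2]
  have h1 := hO.snocFn' (isSigmabFn_hBlk_step PG hR hs)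
  have hRt : IsSigmabFn (k + 1) fun V : Fin (n + 1 + 3) → M =>
      R (Fin.init (Fin.init (Fin.init (Fin.init V)))) :=
    isSigmabFn_of_isTermFn (isTermFn_init4 hR) _
  refine (h1.min₂ hRt).of_eq fun V => ?_
  have ex : ∀ b : M, ((Fin.snoc V b : Fin (n + 1 + 4) → M) ∘ x5) =
      Fin.init (Fin.init (Fin.init (Fin.init V))) := by
    intro b; funext i; simp [x5, Fin.init]
  simp only [hF, ex, cj, cc, cb, Fin.snoc_castSucc, Fin.snoc_last]

/-- The recomputation step is bounded by the value bound: `hF ≤ R ≤ u₀ + R`. [folklore] -/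
theorem hF_le (V : Fin (n + 2 + 2) → M) : hF PG R s V ≤ hr R (Fin.init (Fin.init V)) :=
  (min_le_right _ _).trans (le_add_left'' _ _)

omit hI in
/-- The initial value is bounded by the value bound: `u₀ ≤ u₀ + R`. [folklore] -/
theorem hInit_le (xsw : Fin (n + 2) → M) : hInit xsw ≤ hr R xsw := le_add_right'' _ _

include hR in
omit hI in
/-- `hr` is a term function. [folklore] -/
theorem isTermFn_hr : IsTermFn (hr R : (Fin (n + 2) → M) → M) := isTermFn_init (isTermFn_histR hR)

include hs in
omit hB hI in
/-- `hsN` is a term function. [folklore] -/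
theorem isTermFn_hsN : IsTermFn (hsN s : (Fin (n + 2) → M) → M) :=
  ((hs.comp Fin.castSucc).comp Fin.castSucc).of_eq fun _ => rfl

omit hB hI in
/-- `hInit` is a term function. [folklore] -/
theorem isTermFn_hInit : IsTermFn (hInit : (Fin (n + 2) → M) → M) := IsTermFn.proj _

include hR hs in
/-- **The recomputed state `u_j` is a `Σᵇₖ₊₁`-definable function of `((x̄, u₀), w, j)`**
(`BoundedArithIterate`: the iterate of a `Σᵇ`-definable step). [cite: Buss1986, §2.6] -/
theorem isSigmabFn_hU (hIk : M ⊨ INDScheme (sigmabFormulas (k + 1))) :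
    IsSigmabFn (k + 1) fun u : Fin (n + 1 + 2) → M =>
      hU PG R s (Fin.init (Fin.init u)) (u (Fin.last (n + 1)).castSucc) (u (Fin.last (n + 2))) := by
  have h := isSigmabFn_iter (F := hF PG R s) (init := hInit) (r := hr R) (sN := hsN s)
    (hF_le PG) hInit_le hIk (isSigmabFn_hF PG hR hs)
    (isSigmabFn_of_isTermFn isTermFn_hInit _) (isTermFn_hr hR) (isTermFn_hsN hs)
  refine h.of_eq fun u => ?_
  simp only [hU]
  congr 1
  exact (Fin.snoc_init_self _).symm

include hR hs in
/-- `hU (x̄, u₀) w (J (x̄,u₀) w p)` for a definable `J` of the query context is a definable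
function of the query context. [folklore] -/
theorem isSigmabQFn_hU (hIk : M ⊨ INDScheme (sigmabFormulas (k + 1)))
    {J : (Fin (n + 1) → M) → M → M → M} (hJ : IsSigmabQFn k J) :
    IsSigmabQFn k fun xs w p => hU PG R s xs w (J xs w p) := by
  -- context `((x̄, u₀), w, p, j)`
  have h1 : IsSigmabFn (k + 1) fun V : Fin (n + 1 + 3) → M =>
      hU PG R s (Fin.init (Fin.init (Fin.init V))) (V (Fin.last (n + 1)).castSucc.castSucc)
        (V (Fin.last (n + 3))) := by
    let e : Fin (n + 1 + 2) → Fin (n + 1 + 3) :=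
      Fin.snoc (α := fun _ => Fin (n + 1 + 3)) (fun i : Fin (n + 2) => i.castSucc.castSucc)
        (Fin.last (n + 3))
    refine (IsSigmabFn.comp (isSigmabFn_hU PG hR hs hIk) e).of_eq fun V => ?_
    have e1 : Fin.init (Fin.init (V ∘ e)) = Fin.init (Fin.init (Fin.init V)) := by
      funext i; simp [e, Fin.init]
    have e2 : (V ∘ e) (Fin.last (n + 1)).castSucc = V (Fin.last (n + 1)).castSucc.castSucc := by
      simp [e]
    have e3 : (V ∘ e) (Fin.last (n + 2)) = V (Fin.last (n + 3)) := by simp [e]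
    simp only [e1, e2, e3]
  refine (h1.snocFn' hJ).of_eq fun u => ?_
  simp [Fin.init_snoc, Fin.snoc_castSucc, Fin.snoc_last]

omit hB hI in
/-- Renaming the arguments of a uniformly definable query family. [folklore] -/
theorem _root_.Literature.Computability.MetaComplexity.BASICModel.IsSigmabQuery.relabelArgs
    {n₁ n₂ : ℕ} {Q : (Fin n₁ → M) → M → M → Prop} (hQ : IsSigmabQuery k Q) (g : Fin n₁ → Fin n₂) :
    IsSigmabQuery k fun (y : Fin n₂ → M) w p => Q (y ∘ g) w p := by
  let g' : Fin (n₁ + 2) → Fin (n₂ + 2) :=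
    Fin.snoc (α := fun _ => Fin (n₂ + 2))
      (Fin.snoc (α := fun _ => Fin (n₂ + 2)) (fun j => (g j).castSucc.castSucc)
        (Fin.last n₂).castSucc) (Fin.last (n₂ + 1))
  refine (IsSigmabDef.comp hQ g').of_iff fun u => ?_
  have e1 : Fin.init (Fin.init (u ∘ g')) = Fin.init (Fin.init u) ∘ g := by
    funext j; simp [g', Fin.init]
  have e2 : (u ∘ g') (Fin.last n₁).castSucc = u (Fin.last n₂).castSucc := by simp [g']
  have e3 : (u ∘ g') (Fin.last (n₁ + 1)) = u (Fin.last (n₂ + 1)) := by simp [g']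
  simp only [e1, e2, e3]

omit [Language.boundedArith.Structure M] hB hI in
/-- The index map skipping the coordinate `n` (the initial value `u₀`): `(x̄, a, b) ↦ (x̄, ·, a, b)`.
[folklore] -/
theorem _root_.Literature.Computability.MetaComplexity.BASICModel.snoc_snoc_comp_skip
    (xs : Fin (n + 1) → M) (a b : M) :
    ((Fin.snoc (Fin.snoc xs a : Fin (n + 2) → M) b : Fin (n + 3) → M) ∘
      (Fin.snoc (α := fun _ => Fin (n + 3))
        (Fin.snoc (α := fun _ => Fin (n + 3)) (fun i : Fin n => i.castSucc.castSucc.castSucc)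
          (Fin.last (n + 1)).castSucc) (Fin.last (n + 2)))) =
      Fin.snoc (Fin.snoc (Fin.init xs) a) b := by
  funext i
  cases i using Fin.lastCases with
  | last => simp
  | cast i =>
    cases i using Fin.lastCases with
    | last => simp
    | cast i => simp [Fin.init]

omit hB hI in
/-- **Substitution at the arguments `(x̄, J, U)` built from the base arguments `(x̄, u₀)`** in a
query family of arity `n + 2` (the initial value `u₀` is dropped). [folklore] -/
theorem _root_.Literature.Computability.MetaComplexity.BASICModel.IsSigmabQuery.subst₂'
    {Q : (Fin (n + 2) → M) → M → M → Prop} (hQ : IsSigmabQuery k Q)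
    {J U C D : (Fin (n + 1) → M) → M → M → M} (hJ : IsSigmabQFn k J) (hU : IsSigmabQFn k U)
    (hC : IsSigmabQFn k C) (hD : IsSigmabQFn k D) :
    IsSigmabQuery k fun xs w p =>
      Q (Fin.snoc (Fin.snoc (Fin.init xs) (J xs w p)) (U xs w p)) (C xs w p) (D xs w p) := by
  let e : Fin (n + 2) → Fin (n + 3) :=
    Fin.snoc (α := fun _ => Fin (n + 3))
      (Fin.snoc (α := fun _ => Fin (n + 3)) (fun i : Fin n => i.castSucc.castSucc.castSucc)
        (Fin.last (n + 1)).castSucc) (Fin.last (n + 2))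
  have h := (hQ.relabelArgs e).subst₂ hJ hU hC hD
  refine h.of_iff fun u => ?_
  simp only [e, snoc_snoc_comp_skip]

/-- A term function of arity `n + 2` at the arguments `(x̄, J, U)` built from `(x̄, u₀)` is a
definable function of the query context. [folklore] -/
theorem _root_.Literature.Computability.MetaComplexity.BASICModel.IsSigmabQFn.termArgs₂'
    {T : (Fin (n + 2) → M) → M} (hT : IsTermFn T) {J U : (Fin (n + 1) → M) → M → M → M}
    (hJ : IsSigmabQFn k J) (hU : IsSigmabQFn k U) :
    IsSigmabQFn k fun xs w p => T (Fin.snoc (Fin.snoc (Fin.init xs) (J xs w p)) (U xs w p)) := by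
  -- context `((x̄, u₀), w, p, j, u)` : `Fin (n + 1 + 4)`
  have hT' : IsTermFn fun V : Fin (n + 1 + 4) → M =>
      T (Fin.snoc (Fin.snoc (Fin.init (Fin.init (Fin.init (Fin.init (Fin.init V)))))
        (V (Fin.last (n + 3)).castSucc)) (V (Fin.last (n + 4)))) := by
    refine hT.substAll (T := fun i V => (Fin.snoc (Fin.snoc (Fin.init (Fin.init (Fin.init
      (Fin.init (Fin.init V))))) (V (Fin.last (n + 3)).castSucc) : Fin (n + 1) → M)
        (V (Fin.last (n + 4))) : Fin (n + 2) → M) i) fun i => ?_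
    cases i using Fin.lastCases with
    | last => simpa using IsTermFn.proj (m := n + 1 + 4) (Fin.last (n + 4))
    | cast i =>
      cases i using Fin.lastCases with
      | last => simpa using IsTermFn.proj (m := n + 1 + 4) (Fin.last (n + 3)).castSucc
      | cast i =>
        simpa [Fin.init] using
          IsTermFn.proj (m := n + 1 + 4) i.castSucc.castSucc.castSucc.castSucc.castSucc
  have hU' : IsSigmabFn (k + 1) fun V : Fin (n + 1 + 3) → M =>
      U (Fin.init (Fin.init (Fin.init V))) (V (Fin.last (n + 1)).castSucc.castSucc)
        (V (Fin.last (n + 2)).castSucc) :=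
    (IsSigmabFn.comp hU Fin.castSucc).of_eq fun _ => rfl
  have h1 := ((isSigmabFn_of_isTermFn hT' (k + 1)).snocFn' hU').snocFn' hJ
  refine h1.of_eq fun u => ?_
  simp [Fin.init_snoc, Fin.snoc_castSucc, Fin.snoc_last]

include hR hs in
/-- The block read at position `p`, `hBlk (x̄, u₀) w (p / hΛ)`, is a definable function of the
query context. [folklore] -/
theorem isSigmabQFn_hBlk_pos : IsSigmabQFn k fun xs w p => hBlk PG R s xs w (p / hΛ PG R s xs) := by
  have hSt : IsSigmabQFn k fun xs (_ _ : M) => hS PG R s xs := IsSigmabQFn.args (isTermFn_hS PG hR hs)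
  have hΛt : IsSigmabQFn k fun xs (_ _ : M) => hΛ PG R s xs := IsSigmabQFn.args (isTermFn_hΛ PG hR hs)
  have hLt : IsSigmabQFn k fun xs (_ _ : M) => hL PG R s xs := IsSigmabQFn.args (isTermFn_hL PG hR hs)
  have hm : IsSigmabQFn k fun xs (_ p : M) => p / hΛ PG R s xs := IsSigmabQFn.pos.div hΛt
  have h1 : IsSigmabQFn k fun xs (w _ : M) => w % pow2B (hS PG R s xs) (hL PG R s xs) :=
    IsSigmabQFn.modPow2B hSt hLt IsSigmabQFn.code
  have h2 : IsSigmabQFn k fun xs (_ p : M) => p / hΛ PG R s xs * hΛ PG R s xs := hm.mul hΛt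
  have h3 : IsSigmabQFn k fun xs (w p : M) =>
      w % pow2B (hS PG R s xs) (hL PG R s xs) / pow2B (hS PG R s xs) (p / hΛ PG R s xs * hΛ PG R s xs) :=
    IsSigmabQFn.divPow2B hSt h2 h1
  have h4 : IsSigmabQFn k fun xs (w p : M) =>
      w % pow2B (hS PG R s xs) (hL PG R s xs) / pow2B (hS PG R s xs) (p / hΛ PG R s xs * hΛ PG R s xs) %
        pow2B (hS PG R s xs) (hΛ PG R s xs) :=
    IsSigmabQFn.modPow2B hSt hΛt h3
  exact h4.of_eq fun _ => rfl

include hR hs in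
/-- The step index at position `p`, `ℓ - 1 - p / hΛ`, is a definable function of the query
context. [folklore] -/
theorem isSigmabQFn_stepIndex :
    IsSigmabQFn k fun xs (_ p : M) => histLen s xs - 1 - p / hΛ PG R s xs :=
  ((IsSigmabQFn.args (isTermFn_histLen hs)).sub (IsSigmabQFn.args isTermFn_one)).sub
    (IsSigmabQFn.pos.div (IsSigmabQFn.args (isTermFn_hΛ PG hR hs)))

include hR hs in
/-- **The queries of the iteration are `Σᵇₖ₊₁`-definable uniformly.** [folklore] -/
theorem isSigmabQuery_hQ (hIk : M ⊨ INDScheme (sigmabFormulas (k + 1))) :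
    IsSigmabQuery k (hQ PG R s) := by
  have hJ := isSigmabQFn_stepIndex PG hR hs
  have hUj : IsSigmabQFn k fun xs w p => hU PG R s xs w (histLen s xs - 1 - p / hΛ PG R s xs) :=
    isSigmabQFn_hU PG hR hs hIk hJ
  have hP' : IsSigmabQFn k fun xs (_ p : M) => p % hΛ PG R s xs :=
    IsSigmabQFn.pos.mod (IsSigmabQFn.args (isTermFn_hΛ PG hR hs))
  have hLG : IsSigmabQFn k fun xs w p =>
      PG.L (hArgs PG R s xs w (histLen s xs - 1 - p / hΛ PG R s xs)) :=
    IsSigmabQFn.termArgs₂' PG.isTermFn_L hJ hUj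
  have h1 := IsSigmabQuery.lt hP' hLG
  have h2 := PG.isSigmabQuery.subst₂' hJ hUj (isSigmabQFn_hBlk_pos PG hR hs) hP'
  exact h1.and h2

/-! ### The output: the code of the recomputed states -/

omit [Language.boundedArith.Structure M] hB hI in
/-- The length parameter at `(x̄, u₀, w)`. [folklore] -/
@[simp] theorem hsN_snoc (xs : Fin (n + 1) → M) (w : M) : hsN s (Fin.snoc xs w) = histS s xs := by
  simp [hsN, histS]

omit hI in
/-- The value bound at `(x̄, u₀, w)`. [folklore] -/
@[simp] theorem hr_snoc (xs : Fin (n + 1) → M) (w : M) : hr R (Fin.snoc xs w) = histR R xs := by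
  simp [hr]

omit [Language.boundedArith.Structure M] hB hI in
/-- The initial value at `(x̄, u₀, w)`. [folklore] -/
@[simp] theorem hInit_snoc (xs : Fin (n + 1) → M) (w : M) : hInit (Fin.snoc xs w) = histInit xs := by
  simp [hInit, histInit]

omit hB hI in
/-- `|hsN (x̄, u₀, w)| = ℓ`. [folklore] -/
theorem mLen_hsN_snoc (xs : Fin (n + 1) → M) (w : M) :
    mLen (hsN s (Fin.snoc xs w)) = histLen s xs := by
  simp [hsN, histLen]

include hR hs in
/-- **Existence of the recomputation** of every length `l ≤ ℓ` (in a model of `Σᵇₖ₊₁-IND`).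
[cite: Buss1986, §2.6] -/
theorem exists_isItSeq_hF (hIk : M ⊨ INDScheme (sigmabFormulas (k + 1))) (xs : Fin (n + 1) → M)
    (w : M) {l : M} (hl : l ≤ histLen s xs) :
    ∃ H, IsItSeq (hF PG R s) hInit (hr R) (hsN s) (Fin.snoc xs w) l H :=
  exists_isItSeq (F := hF PG R s) (init := hInit) (r := hr R) (sN := hsN s) (hF_le PG) hInit_le
    hIk (isSigmabFn_hF PG hR hs) (isSigmabFn_of_isTermFn isTermFn_hInit _) (isTermFn_hr hR)
    (isTermFn_hsN hs) (Fin.snoc xs w) (by rwa [mLen_hsN_snoc])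

include hR hs in
/-- `hOUT (x̄, u₀) w` is a recomputation of full length `ℓ`. [folklore] -/
theorem isItSeq_hOUT (hIk : M ⊨ INDScheme (sigmabFormulas (k + 1))) (xs : Fin (n + 1) → M)
    (w : M) : IsItSeq (hF PG R s) hInit (hr R) (hsN s) (Fin.snoc xs w) (histLen s xs)
      (hOUT PG R s xs w) := by
  have h := exists_isItSeq_hF PG hR hs hIk xs w (le_refl (histLen s xs))
  rw [hOUT, dif_pos h]
  exact Classical.choose_spec h

include hR hs in
/-- Any recomputation of full length is `hOUT`. [folklore] -/
theorem eq_hOUT (hIk : M ⊨ INDScheme (sigmabFormulas (k + 1))) {xs : Fin (n + 1) → M} {w H : M}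
    (hH : IsItSeq (hF PG R s) hInit (hr R) (hsN s) (Fin.snoc xs w) (histLen s xs) H) :
    H = hOUT PG R s xs w :=
  hH.unique (by rw [mLen_hsN_snoc]) (isItSeq_hOUT PG hR hs hIk xs w)

include hR hs in
/-- **The output of the iteration is `Σᵇₖ₊₁`-definable uniformly** (its graph is `IsItSeq` of
full length). [folklore] -/
theorem isSigmabOut_hOUT (hIk : M ⊨ INDScheme (sigmabFormulas (k + 1))) :
    IsSigmabOut k (hOUT PG R s) := by
  -- `IsItSeq` on the context `((x̄, u₀, w), l, H)`, then `l := ℓ` and the swap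
  have hSeq := isSigmabDef_isItSeq (F := hF PG R s) (init := hInit) (r := hr R) (sN := hsN s)
    (i := k) (isSigmabFn_hF PG hR hs) (isSigmabFn_of_isTermFn isTermFn_hInit _)
    (isTermFn_hr hR) (isTermFn_hsN hs) (hF_le PG)
  have hSeq' := (hSeq.comp (swapLastTwo (n + 2))).snoc
    (G := fun v : Fin (n + 2 + 1) → M => histLen s (Fin.init (Fin.init v)))
    (((isTermFn_histLen hs).comp Fin.castSucc).comp Fin.castSucc |>.of_eq fun _ => rfl)
  have hR' : IsSigmabDef (k + 1) fun v : Fin (n + 2 + 1) → M =>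
      IsItSeq (hF PG R s) hInit (hr R) (hsN s) (Fin.init v) (histLen s (Fin.init (Fin.init v)))
        (v (Fin.last (n + 2))) := by
    refine hSeq'.of_iff fun v => ?_
    simp only [comp_swapLastTwo, Fin.init_snoc, Fin.snoc_last, Fin.snoc_castSucc]
  refine IsSigmabFn.of_unique hR' (fun u => ?_) (fun u y hy => ?_) ?_
  · simp only [Fin.init_snoc, Fin.snoc_last]
    have h := isItSeq_hOUT PG hR hs hIk (Fin.init u) (u (Fin.last (n + 1)))
    rwa [Fin.snoc_init_self] at h
  · simp only [Fin.init_snoc, Fin.snoc_last] at hy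
    have h := eq_hOUT PG hR hs hIk (xs := Fin.init u) (w := u (Fin.last (n + 1))) (H := y)
    rw [Fin.snoc_init_self] at h
    exact h hy
  · refine ⟨fun u => 2 * itBound (hr R) (hsN s) u + 1,
      isTermFn_add_one (isTermFn_two_mul ((isTermFn_add_one (isTermFn_two_mul
        (isTermFn_hsN hs))).smash (isTermFn_add_one (isTermFn_two_mul (isTermFn_hr hR))))),
      fun u => ?_⟩
    rw [mLe_iff]
    have h := (isItSeq_hOUT PG hR hs hIk (Fin.init u) (u (Fin.last (n + 1)))).1
    rw [Fin.snoc_init_self] at h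
    exact h.le.trans (pow2B_le _ _)

/-! ### Bits of the blocks -/

/-- A block is `< 2^{hΛ}`. [folklore] -/
theorem hBlk_lt (xs : Fin (n + 1) → M) (w m : M) :
    hBlk PG R s xs w m < pow2B (hS PG R s xs) (hΛ PG R s xs) := mod_pow2B_lt _ _ _

/-- Without steps all blocks vanish (`hL = 0`). [folklore] -/
theorem hBlk_eq_zero_of_histLen {xs : Fin (n + 1) → M} (h : histLen s xs = 0) (w m : M) :
    hBlk PG R s xs w m = 0 := by
  rw [hBlk, hL, h, zero_mul, pow2B_zero, mod_one', zero_div', zero_mod']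

/-- Blocks beyond the last one vanish: `hBlk w m = 0` for `m ≥ ℓ`. [folklore] -/
theorem hBlk_eq_zero_of_le {xs : Fin (n + 1) → M} {m : M} (hm : histLen s xs ≤ m) (w : M) :
    hBlk PG R s xs w m = 0 := by
  rw [hBlk]
  have h1 : w % pow2B (hS PG R s xs) (hL PG R s xs) < pow2B (hS PG R s xs) (m * hΛ PG R s xs) :=
    lt_of_lt_of_le (mod_pow2B_lt _ _ _) (pow2B_mono _ (mul_le_mul'' hm le_rfl))
  rw [(div_eq_zero_iff' (pow2B_pos _ _)).2 h1, zero_mod']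

/-- Bits inside a block: bit `q < hΛ` of block `m < ℓ` is bit `q + m·hΛ` of the code. [folklore] -/
theorem seqEl_hBlk {xs : Fin (n + 1) → M} {m q : M} (hm : m < histLen s xs) (hq : q < hΛ PG R s xs)
    (w : M) : seqEl (hS PG R s xs) 1 (hBlk PG R s xs w m) q =
      seqEl (hS PG R s xs) 1 w (q + m * hΛ PG R s xs) := by
  have hℓ : 1 ≤ histLen s xs := one_le_of_lt hm
  have hΛS := hΛ_le_mLen_hS PG (R := R) hℓ
  have h1 : q + m * hΛ PG R s xs < hL PG R s xs :=
    calc q + m * hΛ PG R s xs < hΛ PG R s xs + m * hΛ PG R s xs := by gcongr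
      _ = (m + 1) * hΛ PG R s xs := by ring
      _ ≤ hL PG R s xs := succ_mul_hΛ_le PG hm
  have h2 : q + m * hΛ PG R s xs + 1 ≤ mLen (hS PG R s xs) :=
    ((add_one_le_iff' _ _).2 h1).trans (hL_le PG xs)
  rw [hBlk, seqEl_one_mod_pow2B hq hΛS, seqEl_one_div_pow2B h2, seqEl_one_mod_pow2B h1 (hL_le PG xs)]

/-- Bits outside a block vanish: bit `q ≥ hΛ` of a block is `0` (at least one step). [folklore] -/
theorem seqEl_hBlk_eq_zero {xs : Fin (n + 1) → M} (hℓ : 1 ≤ histLen s xs) {q : M}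
    (hq : hΛ PG R s xs ≤ q) (w m : M) : seqEl (hS PG R s xs) 1 (hBlk PG R s xs w m) q = 0 :=
  seqEl_one_eq_zero_of_lt' (hBlk_lt PG xs w m) (hΛ_le_mLen_hS PG hℓ) hq

/-- **Block equality from bit agreement**: if two codes have the same bits at all positions
`q > p` (below `|hS|`), then their blocks number `m > p / hΛ` coincide. [folklore] -/
theorem hBlk_eq_of_bits {xs : Fin (n + 1) → M} {w w' p m : M} (hpm : p / hΛ PG R s xs < m)
    (h : ∀ q, p < q → q + 1 ≤ mLen (hS PG R s xs) →
      seqEl (hS PG R s xs) 1 w q = seqEl (hS PG R s xs) 1 w' q) :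
    hBlk PG R s xs w m = hBlk PG R s xs w' m := by
  rcases le_or_gt (histLen s xs) m with hm | hm
  · rw [hBlk_eq_zero_of_le PG hm, hBlk_eq_zero_of_le PG hm]
  have hℓ : 1 ≤ histLen s xs := one_le_of_lt hm
  rcases eq_or_ne (hΛ PG R s xs) 0 with hΛ0 | hΛ0
  · -- no queries per step: every block is `0 mod 2^0 = 0`
    rw [hBlk, hBlk, hΛ0, pow2B_zero, mod_one', mod_one']
  have hΛpos : 0 < hΛ PG R s xs := (pos_iff_ne_zero' _).2 hΛ0
  have hpm' : p < m * hΛ PG R s xs :=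
    calc p < (p / hΛ PG R s xs + 1) * hΛ PG R s xs := lt_div_add_one_mul p hΛpos
      _ ≤ m * hΛ PG R s xs := mul_le_mul'' ((add_one_le_iff' _ _).2 hpm) le_rfl
  refine ext_of_seqEl_one (hΛ_le_mLen_hS PG hℓ) (hBlk_lt PG xs w m) (hBlk_lt PG xs w' m)
    fun q hq => ?_
  rw [seqEl_hBlk PG hm hq, seqEl_hBlk PG hm hq]
  refine h _ (lt_of_lt_of_le hpm' (le_add_left'' _ _)) ?_
  have h1 : q + m * hΛ PG R s xs < hL PG R s xs :=
    calc q + m * hΛ PG R s xs < hΛ PG R s xs + m * hΛ PG R s xs := by gcongr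
      _ = (m + 1) * hΛ PG R s xs := by ring
      _ ≤ hL PG R s xs := succ_mul_hΛ_le PG hm
  exact ((add_one_le_iff' _ _).2 h1).trans (hL_le PG xs)

/-! ### The recomputed states -/

/-- `u₀`: the state before step `0` is the initial value. [cite: Buss1986, §2.6] -/
theorem hU_zero (xs : Fin (n + 1) → M) (w : M) : hU PG R s xs w 0 = xs (Fin.last n) := by
  rw [hU, iter_zero hInit_le]
  simp [hInit]

include hR hs in
/-- `u_{j+1} = min (OUT_G (x̄, j, u_j) (block ℓ-1-j)) (R x̄)` for `j + 1 ≤ ℓ`. [cite: Buss1986, §2.6] -/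
theorem hU_succ (hIk : M ⊨ INDScheme (sigmabFormulas (k + 1))) {xs : Fin (n + 1) → M} {w j : M}
    (hj : j + 1 ≤ histLen s xs) :
    hU PG R s xs w (j + 1) = min (PG.OUT (hArgs PG R s xs w j)
      (hBlk PG R s xs w (histLen s xs - 1 - j))) (R (Fin.init xs)) := by
  rw [hU, iter_succ (hF_le PG) hInit_le hIk (isSigmabFn_hF PG hR hs)
    (isSigmabFn_of_isTermFn isTermFn_hInit _) (isTermFn_hr hR) (isTermFn_hsN hs)
    (by rwa [mLen_hsN_snoc])]
  simp only [hF, hArgs, hU, Fin.init_snoc, Fin.snoc_castSucc, Fin.snoc_last, histLen]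

include hR hs in
/-- The recomputed states are bounded by the value bound. [cite: Buss1986, §2.6] -/
theorem hU_le (hIk : M ⊨ INDScheme (sigmabFormulas (k + 1))) (xs : Fin (n + 1) → M) (w j : M) :
    hU PG R s xs w j ≤ histR R xs := by
  have h := iter_le (hF_le PG) hInit_le hIk (isSigmabFn_hF PG hR hs)
    (isSigmabFn_of_isTermFn isTermFn_hInit _) (isTermFn_hr hR) (isTermFn_hsN hs) (Fin.snoc xs w) j
  rwa [hr_snoc] at h

include hR hs in
/-- **State equality from bit agreement**: if two codes have the same bits above `p`, the
recomputed states before the steps `j ≤ ℓ - 1 - p / hΛ` (whose blocks lie above `p`) coincide.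
By `Δᵇₖ₊₁`… i.e. `Σᵇₖ₊₁`-induction on `j` (an equation between two `Σᵇₖ₊₁`-definable functions
of `j`, the codes being parameters). [folklore] -/
theorem hU_eq_of_bits (hIk : M ⊨ INDScheme (sigmabFormulas (k + 1))) {xs : Fin (n + 1) → M}
    {w w' p : M} (h : ∀ q, p < q → q + 1 ≤ mLen (hS PG R s xs) →
      seqEl (hS PG R s xs) 1 w q = seqEl (hS PG R s xs) 1 w' q) :
    ∀ j, j ≤ histLen s xs - 1 - p / hΛ PG R s xs → hU PG R s xs w j = hU PG R s xs w' j := by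
  set J₀ := histLen s xs - 1 - p / hΛ PG R s xs with hJ₀
  have hJ₀ℓ : J₀ ≤ histLen s xs := tsub_le_self.trans tsub_le_self
  intro j
  refine ind_level hIk (P := fun j => j ≤ J₀ → hU PG R s xs w j = hU PG R s xs w' j) ?_ ?_ ?_ j
  · -- definability: `j ≤ J₀ → U(j) = U'(j)`
    have hUw : ∀ v : M, IsSigmabFn (k + 1) fun t : Fin 1 → M => hU PG R s xs v (t 0) := by
      intro v
      have h1 := isSigmabFn_hU PG hR hs hIk
      refine (h1.substAll (T := fun i (t : Fin 1 → M) =>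
        (Fin.snoc (Fin.snoc xs v : Fin (n + 2) → M) (t 0) : Fin (n + 1 + 2) → M) i) fun i => ?_).of_eq
        fun t => ?_
      · cases i using Fin.lastCases with
        | last => simpa using IsTermFn.proj (m := 1) 0
        | cast i => simpa using IsTermFn.const (m := 1) ((Fin.snoc xs v : Fin (n + 2) → M) i)
      · simp
    refine (IsSigmabDef.imp ((isQFDef_le (IsTermFn.proj 0) (IsTermFn.const J₀)).isPibDef _)
      ((hUw w).isDeltabDef_eq (hUw w')).1).of_iff fun v => ?_
    simp
  · intro _
    rw [hU_zero, hU_zero]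
  · intro j ih hj1
    have hjJ : j < J₀ := (add_one_le_iff' _ _).1 hj1
    have hjℓ : j + 1 ≤ histLen s xs := hj1.trans hJ₀ℓ
    have hm : p / hΛ PG R s xs < histLen s xs - 1 - j := by
      -- from `j + 1 ≤ ℓ - 1 - p/Λ`
      have h' := hj1
      rw [hJ₀] at h'
      exact lt_tsub_comm.mp ((add_one_le_iff' _ _).1 h')
    rw [hU_succ PG hR hs hIk hjℓ, hU_succ PG hR hs hIk hjℓ, hArgs, hArgs, ih hjJ.le,
      hBlk_eq_of_bits PG hm h]

include hR hs in
/-- **The queries of the iteration are causal.** [folklore] -/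
theorem isCausal_hQ (hIk : M ⊨ INDScheme (sigmabFormulas (k + 1))) (xs : Fin (n + 1) → M) :
    IsCausal₁ (hQ PG R s xs) (hS PG R s xs) := by
  intro w w' p hbits
  set Λ := hΛ PG R s xs with hΛdef
  set m₀ := p / Λ with hm₀
  set j₀ := histLen s xs - 1 - m₀ with hj₀
  have hU0 : hU PG R s xs w j₀ = hU PG R s xs w' j₀ := hU_eq_of_bits PG hR hs hIk hbits j₀ le_rfl
  have hA : hArgs PG R s xs w j₀ = hArgs PG R s xs w' j₀ := by rw [hArgs, hArgs, hU0]
  simp only [hQ, ← hΛdef, ← hm₀, ← hj₀, hA]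
  refine and_congr_right fun _ => ?_
  refine PG.isCausal (hArgs PG R s xs w' j₀) _ _ _ fun q hpq hqS => ?_
  set SG := PG.S (hArgs PG R s xs w' j₀) with hSG
  rcases le_or_gt (histLen s xs) m₀ with hm | hm
  · rw [hBlk_eq_zero_of_le PG hm, hBlk_eq_zero_of_le PG hm]
  have hℓ : 1 ≤ histLen s xs := one_le_of_lt hm
  rcases eq_or_ne Λ 0 with hΛ0 | hΛ0
  · have e : ∀ v : M, hBlk PG R s xs v m₀ = 0 := fun v => by
      rw [hBlk, ← hΛdef, hΛ0, pow2B_zero, mod_one']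
    rw [e, e]
  have hΛpos : 0 < Λ := (pos_iff_ne_zero' _).2 hΛ0
  rcases lt_or_ge q Λ with hq | hq
  · have hq1 : q + m₀ * Λ < hL PG R s xs :=
      calc q + m₀ * Λ < Λ + m₀ * Λ := by gcongr
        _ = (m₀ + 1) * Λ := by ring
        _ ≤ hL PG R s xs := succ_mul_hΛ_le PG hm
    have hqS' : q + 1 ≤ mLen (hS PG R s xs) :=
      ((add_one_le_iff' _ _).2 hq).trans (hΛ_le_mLen_hS PG hℓ)
    rw [← seqEl_one_congr hqS' hqS, ← seqEl_one_congr hqS' hqS, seqEl_hBlk PG hm hq,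
      seqEl_hBlk PG hm hq]
    refine hbits _ ?_ (((add_one_le_iff' _ _).2 hq1).trans (hL_le PG xs))
    calc p = m₀ * Λ + p % Λ := by rw [hm₀, div_add_mod' p Λ]
      _ < m₀ * Λ + q := by gcongr
      _ = q + m₀ * Λ := add_comm _ _
  · have hΛS : Λ ≤ mLen SG := hq.trans ((le_add_right'' q 1).trans hqS)
    have hb : pow2B (hS PG R s xs) Λ = pow2B SG Λ := pow2B_congr (hΛ_le_mLen_hS PG hℓ) hΛS
    rw [seqEl_one_eq_zero_of_lt' (hb ▸ hBlk_lt PG xs w m₀) hΛS hq,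
      seqEl_one_eq_zero_of_lt' (hb ▸ hBlk_lt PG xs w' m₀) hΛS hq]

/-! ### The presentation of the iteration -/

include hR hs in
/-- **The presentation of the truncated iteration with history** `histFn G R s` of the function
`G` presented by `PG` (Buss 1990, Thm. 11(b): the answer string of the iteration is the
concatenation of the answer strings of the steps; here step `0` on top). In a model of
`Σᵇₖ₊₁-IND` (needed for the recomputation of the states). [cite: BussContempMath1990, Thm. 11(b)] -/
noncomputable def hist (hIk : M ⊨ INDScheme (sigmabFormulas (k + 1))) : QPres M k (n + 1) where
  L := hL PG R s
  S := hS PG R s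
  Q := hQ PG R s
  OUT := hOUT PG R s
  isTermFn_L := isTermFn_hL PG hR hs
  isTermFn_S := isTermFn_hS PG hR hs
  L_le := hL_le PG
  one_le := one_le_mLen_hS PG
  isSigmabQuery := isSigmabQuery_hQ PG hR hs hIk
  isCausal := isCausal_hQ PG hR hs hIk
  isSigmabOut := isSigmabOut_hOUT PG hR hs hIk

/-! ### Correctness: the blocks of the answer code are the answer codes of the steps -/

variable {PG}

include hR hs in
/-- The arguments of step `j < ℓ` are dominated by `hPad`. [folklore] -/
theorem hArgs_le_hPad (hIk : M ⊨ INDScheme (sigmabFormulas (k + 1))) (xs : Fin (n + 1) → M)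
    (w : M) {j : M} (hj : j < histLen s xs) :
    ∀ i, hArgs PG R s xs w j i ≤ hPad R s xs i := by
  refine snoc_le_snoc (snoc_le_snoc (fun _ => le_rfl) ?_) (hU_le PG hR hs hIk xs w j)
  exact hj.le.trans (mLen_le_self _)

include hR hs in
/-- The number of queries of step `j < ℓ` is at most the padded number `hΛ`. [folklore] -/
theorem LG_hArgs_le (hIk : M ⊨ INDScheme (sigmabFormulas (k + 1))) (xs : Fin (n + 1) → M)
    (w : M) {j : M} (hj : j < histLen s xs) : PG.L (hArgs PG R s xs w j) ≤ hΛ PG R s xs :=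
  PG.isTermFn_L.monotone (hArgs_le_hPad hR hs hIk xs w hj)

/-- Division with remainder of a position inside block `m`: `(q + m·Λ) / Λ = m`,
`(q + m·Λ) mod Λ = q` for `q < Λ`. [folklore] -/
theorem pos_div_mod {Λ q m : M} (hq : q < Λ) :
    (q + m * Λ) / Λ = m ∧ (q + m * Λ) % Λ = q :=
  div_mod_eq_of hq (by ring)

/-- `ℓ - 1 - (ℓ - 1 - j) = j` for `j < ℓ`. [folklore] -/
theorem stepIndex_cancel {ℓ j : M} (hj : j < ℓ) : ℓ - 1 - (ℓ - 1 - j) = j :=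
  tsub_tsub_cancel_of_le (by
    have h1 : j + 1 ≤ ℓ := (add_one_le_iff' _ _).2 hj
    exact le_tsub_of_add_le_right h1)

/-- `ℓ - 1 - j < ℓ` for `j < ℓ`. [folklore] -/
theorem stepIndex_lt {ℓ j : M} (hj : j < ℓ) : ℓ - 1 - j < ℓ :=
  tsub_le_self.trans_lt (tsub_lt_self (lt_of_le_of_lt bot_le hj) zero_lt_one)

include hR hs in
/-- **The block of step `j` of the answer code of the iteration is the answer code of `G` at
`(x̄, j, u_j)`** (block lemma: its bits are the corresponding bits, its queries the corresponding
queries, and the padding bits vanish). [cite: BussContempMath1990, Thm. 11(b)] -/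
theorem hBlk_code (hIk : M ⊨ INDScheme (sigmabFormulas (k + 1))) (xs : Fin (n + 1) → M) {j : M}
    (hj : j < histLen s xs) :
    hBlk PG R s xs ((hist PG hR hs hIk).code xs) (histLen s xs - 1 - j) =
      PG.code (hArgs PG R s xs ((hist PG hR hs hIk).code xs) j) := by
  set W := (hist PG hR hs hIk).code xs with hWdef
  have hW : IsAnswerCode (hQ PG R s xs) (hS PG R s xs) (hL PG R s xs) W :=
    (hist PG hR hs hIk).isAnswerCode_code hIk xs
  set ℓ := histLen s xs with hℓdef
  set Λ := hΛ PG R s xs with hΛdef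
  set m := ℓ - 1 - j with hmdef
  set args := hArgs PG R s xs W j with hargs
  have hm : m < ℓ := stepIndex_lt hj
  have hmj : ℓ - 1 - m = j := stepIndex_cancel hj
  have hℓ1 : 1 ≤ ℓ := one_le_of_lt hj
  have hLG : PG.L args ≤ Λ := LG_hArgs_le hR hs hIk xs W hj
  have hΛS : Λ ≤ mLen (hS PG R s xs) := hΛ_le_mLen_hS PG hℓ1
  have hS1 : 1 ≤ mLen (hS PG R s xs) := one_le_mLen_hS PG xs
  -- the queries at the positions of block `m`
  have hQpos : ∀ q, q < Λ → (hQ PG R s xs W (q + m * Λ) ↔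
      (q < PG.L args ∧ PG.Q args (hBlk PG R s xs W m) q)) := by
    intro q hq
    obtain ⟨h1, h2⟩ := pos_div_mod (m := m) hq
    simp only [hQ, ← hΛdef, ← hℓdef, h1, h2, hmj, ← hargs]
  -- positions of block `m` are below `hL`
  have hposL : ∀ q, q < Λ → q + m * Λ < hL PG R s xs := fun q hq =>
    calc q + m * Λ < Λ + m * Λ := by gcongr
      _ = (m + 1) * Λ := by ring
      _ ≤ hL PG R s xs := succ_mul_hΛ_le PG hm
  -- the padding bits vanish
  have hpad : ∀ q, PG.L args ≤ q → q < Λ → seqEl (hS PG R s xs) 1 (hBlk PG R s xs W m) q = 0 := by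
    intro q hq1 hq2
    rw [seqEl_hBlk PG hm hq2]
    refine hW.bit_eq_zero hS1 (hposL q hq2) ?_
    rw [hQpos q hq2]
    exact fun h => (not_le.2 h.1) hq1
  refine PG.eq_code (hW.block (off := m * Λ) (L' := PG.L args) ?_ ?_ ?_ ?_)
  · calc m * Λ + PG.L args ≤ m * Λ + Λ := by gcongr
      _ = (m + 1) * Λ := by ring
      _ ≤ hL PG R s xs := succ_mul_hΛ_le PG hm
  · rw [← pow2B_congr (hLG.trans hΛS) (PG.L_le _)]
    exact lt_pow2B_of_seqEl_eq_zero hΛS hLG (hBlk_lt PG xs W m) hpad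
  · intro q hq
    have hqΛ : q < Λ := lt_of_lt_of_le hq hLG
    rw [← seqEl_one_congr (((add_one_le_iff' _ _).2 hqΛ).trans hΛS)
      (((add_one_le_iff' _ _).2 hq).trans (PG.L_le _))]
    exact seqEl_hBlk PG hm hqΛ W
  · intro q hq
    rw [hQpos q (lt_of_lt_of_le hq hLG)]
    exact ⟨fun h => h.2, fun h => ⟨hq, h⟩⟩

include hR hs in
/-- The output of `G` read off the block of step `j` is the value `G(x̄, j, u_j)`. [folklore] -/
theorem out_hBlk_eq (hIk : M ⊨ INDScheme (sigmabFormulas (k + 1))) (xs : Fin (n + 1) → M)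
    {j : M} (hj : j < histLen s xs) :
    PG.OUT (hArgs PG R s xs ((hist PG hR hs hIk).code xs) j)
        (hBlk PG R s xs ((hist PG hR hs hIk).code xs) (histLen s xs - 1 - j)) =
      PG.eval (hArgs PG R s xs ((hist PG hR hs hIk).code xs) j) := by
  rw [hBlk_code hR hs hIk xs hj]
  rfl

/-! ### Correctness: the output codes the iteration of `G` -/

section Restrict

variable {m : ℕ} {F : (Fin (m + 2) → M) → M} {init r sN : (Fin m → M) → M}

/-- Truncating a computation of length `l + 1` to one of length `j + 1`, `j ≤ l`. [folklore] -/
theorem _root_.Literature.Computability.MetaComplexity.BASICModel.IsItSeq.restrictLE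
    {xs : Fin m → M} {l j H : M} (hj : j ≤ l) (hl : l ≤ mLen (sN xs))
    (h : IsItSeq F init r sN xs l H) :
    IsItSeq F init r sN xs j (H % pow2B (itBound r sN xs) ((j + 1) * itWidth r xs)) := by
  have hle : (j + 1) * itWidth r xs ≤ mLen (itBound r sN xs) := itExp_le (by gcongr; exact hj.trans hl)
  refine ⟨mod_pow2B_lt _ _ _, ?_, fun j' hj' hj'j => ?_⟩
  · rw [seqEl_mod_pow2B (zero_lt_add_one' j) hle, h.2.1]
  · have h1 : j' + 1 < j + 1 := by simpa using hj'j
    rw [seqEl_mod_pow2B h1 hle, seqEl_mod_pow2B (hj'j.trans (lt_add_one' j)) hle]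
    exact h.2.2 j' hj' (lt_of_lt_of_le hj'j hj)

end Restrict

include hR hs in
/-- The recomputed state `u_j` is the digit `j` of the output code (`j ≤ ℓ`). [folklore] -/
theorem hU_eq_seqEl_hOUT (hIk : M ⊨ INDScheme (sigmabFormulas (k + 1))) (xs : Fin (n + 1) → M)
    (w : M) {j : M} (hj : j ≤ histLen s xs) :
    hU PG R s xs w j = seqEl (itBound (hr R) (hsN s) (Fin.snoc xs w)) (itWidth (hr R) (Fin.snoc xs w))
      (hOUT PG R s xs w) j := by
  have hH := isItSeq_hOUT PG hR hs hIk xs w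
  have hl : histLen s xs ≤ mLen (hsN s (Fin.snoc xs w)) := by rw [mLen_hsN_snoc]
  have hres := hH.restrictLE hj hl
  rw [hU, iter_eq_seqEl (hj.trans hl) hres, seqEl_mod_pow2B (lt_add_one' j)
    (itExp_le (by gcongr; exact hj.trans hl))]

omit hI in
/-- The length bound of the two iteration frames agree. [folklore] -/
theorem itBound_snoc (xs : Fin (n + 1) → M) (w : M) :
    itBound (hr R) (hsN s) (Fin.snoc xs w) = itBound (histR R) (histS s) xs := by
  simp only [itBound, hr_snoc, hsN_snoc]

omit hI in
/-- The digit width of the two iteration frames agree. [folklore] -/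
theorem itWidth_snoc (xs : Fin (n + 1) → M) (w : M) :
    itWidth (hr R) (Fin.snoc xs w) = itWidth (histR R) xs := by
  simp only [itWidth, hr_snoc]

include hR hs in
/-- **The output of the iteration codes the truncated iteration of `G`** (`G = PG.eval`): the
recomputed states are the states of the iteration of `G`, because each step reads the answer
code of `G` at the current state. [cite: BussContempMath1990, Thm. 11(b)] -/
theorem isItSeq_histStep_hOUT (hIk : M ⊨ INDScheme (sigmabFormulas (k + 1))) (xs : Fin (n + 1) → M) :
    IsItSeq (histStep PG.eval R) histInit (histR R) (histS s) xs (histLen s xs)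
      (hOUT PG R s xs ((hist PG hR hs hIk).code xs)) := by
  set W := (hist PG hR hs hIk).code xs with hWdef
  have hH := isItSeq_hOUT PG hR hs hIk xs W
  rw [IsItSeq, itBound_snoc, itWidth_snoc] at hH
  obtain ⟨h1, h2, h3⟩ := hH
  refine ⟨h1, by simpa using h2, fun j hjS hjℓ => ?_⟩
  have hstep := h3 j hjS hjℓ
  rw [hstep]
  -- the state read by the recomputation step is `u_j`
  set c := seqEl (itBound (histR R) (histS s) xs) (itWidth (histR R) xs) (hOUT PG R s xs W) j with hc
  have hcu : c = hU PG R s xs W j := by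
    rw [hc, hU_eq_seqEl_hOUT (PG := PG) hR hs hIk xs W hjℓ.le, itBound_snoc, itWidth_snoc]
  have hA : (Fin.snoc (Fin.snoc (Fin.init xs) j) c : Fin (n + 2) → M) = hArgs PG R s xs W j := by
    rw [hArgs, hcu]
  have hout := out_hBlk_eq (PG := PG) hR hs hIk xs hjℓ
  rw [← hA] at hout
  simp only [hF, histStep, Fin.init_snoc, Fin.snoc_castSucc, Fin.snoc_last, histLen] at hout ⊢
  rw [hout]

include hR hs in
/-- **Value of the iteration presentation**: `histFn PG.eval R s` (Buss 1990, Thm. 11(b)).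
[cite: BussContempMath1990, Thm. 11(b)] -/
theorem eval_hist (hIk : M ⊨ INDScheme (sigmabFormulas (k + 1))) (xs : Fin (n + 1) → M) :
    (hist PG hR hs hIk).eval xs = histFn PG.eval R s xs := by
  have h := isItSeq_histStep_hOUT (PG := PG) hR hs hIk xs
  have hex : ∃ H, IsItSeq (histStep PG.eval R) histInit (histR R) (histS s) xs (histLen s xs) H :=
    ⟨_, h⟩
  change hOUT PG R s xs ((hist PG hR hs hIk).code xs) = _
  rw [histFn, histCode, dif_pos hex]
  exact h.unique le_rfl (Classical.choose_spec hex)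

end QPres

/-! ### Conclusions for `histFn` -/

/-- `histStep` and hence `histFn` depend on `G` only extensionally. [folklore] -/
theorem histFn_congr {G G' : (Fin (n + 2) → M) → M} (h : ∀ v, G v = G' v) (R s : (Fin n → M) → M) :
    histFn G R s = histFn G' R s := by
  have e : histStep G R = histStep G' R := by
    funext V; simp only [histStep, h]
  rw [histFn, histFn, e]

/-- **Limited iteration** (Buss 1990, Thm. 11(b), semantically): if `G` is query-presentable at
level `k + 1` and `R, s` are term functions, then `histFn G R s` is query-presentable (in a model
of `BASIC + Σᵇ₁-IND + Σᵇₖ₊₁-IND`). [cite: BussContempMath1990, Thm. 11(b)] -/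
theorem IsQFn.histFn (hIk : M ⊨ INDScheme (sigmabFormulas (k + 1))) {G : (Fin (n + 2) → M) → M}
    (hG : IsQFn k G) {R s : (Fin n → M) → M} (hR : IsTermFn R) (hs : IsTermFn s) :
    IsQFn k (histFn G R s) := by
  obtain ⟨PG, hPG⟩ := hG
  refine ⟨QPres.hist PG hR hs hIk, fun xs => ?_⟩
  rw [QPres.eval_hist hR hs hIk, histFn_congr hPG]

/-- **`histFn G R s (x̄, u₀)` codes the truncated iteration of `G`** (digits of width
`|u₀ + R x̄|` under `itBound`): digit `0` is `u₀` and digit `j + 1` is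
`min (G(x̄, j, digit j)) (R x̄)` for `j < |s x̄|`. [cite: BussContempMath1990, Thm. 11(b)] -/
theorem isItSeq_histFn (hIk : M ⊨ INDScheme (sigmabFormulas (k + 1))) {G : (Fin (n + 2) → M) → M}
    (hG : IsQFn k G) {R s : (Fin n → M) → M} (hR : IsTermFn R) (hs : IsTermFn s)
    (xs : Fin (n + 1) → M) :
    IsItSeq (histStep G R) histInit (histR R) (histS s) xs (histLen s xs) (histFn G R s xs) := by
  obtain ⟨PG, hPG⟩ := hG
  have e : histStep G R = histStep PG.eval R := by
    funext V; simp only [histStep, hPG]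
  rw [histFn_congr hPG, ← QPres.eval_hist hR hs hIk, e]
  exact QPres.isItSeq_histStep_hOUT hR hs hIk xs

/-- The code of the iteration is below `2^{(ℓ+1)·width}`. [folklore] -/
theorem histFn_lt (hIk : M ⊨ INDScheme (sigmabFormulas (k + 1))) {G : (Fin (n + 2) → M) → M}
    (hG : IsQFn k G) {R s : (Fin n → M) → M} (hR : IsTermFn R) (hs : IsTermFn s)
    (xs : Fin (n + 1) → M) :
    histFn G R s xs < pow2B (itBound (histR R) (histS s) xs)
      ((histLen s xs + 1) * itWidth (histR R) xs) :=
  (isItSeq_histFn hIk hG hR hs xs).1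

/-- **Recursion equation, base**: digit `0` of `histFn G R s (x̄, u₀)` is `u₀`.
[cite: BussContempMath1990, Thm. 11(b)] -/
theorem seqEl_histFn_zero (hIk : M ⊨ INDScheme (sigmabFormulas (k + 1)))
    {G : (Fin (n + 2) → M) → M} (hG : IsQFn k G) {R s : (Fin n → M) → M} (hR : IsTermFn R)
    (hs : IsTermFn s) (xs : Fin (n + 1) → M) :
    seqEl (itBound (histR R) (histS s) xs) (itWidth (histR R) xs) (histFn G R s xs) 0 =
      xs (Fin.last n) :=
  (isItSeq_histFn hIk hG hR hs xs).2.1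

/-- **Recursion equation, step**: digit `j + 1` of `histFn G R s (x̄, u₀)` is
`min (G(x̄, j, digit j)) (R x̄)`, for `j < |s x̄|`. [cite: BussContempMath1990, Thm. 11(b)] -/
theorem seqEl_histFn_succ (hIk : M ⊨ INDScheme (sigmabFormulas (k + 1)))
    {G : (Fin (n + 2) → M) → M} (hG : IsQFn k G) {R s : (Fin n → M) → M} (hR : IsTermFn R)
    (hs : IsTermFn s) (xs : Fin (n + 1) → M) {j : M} (hj : j < histLen s xs) :
    seqEl (itBound (histR R) (histS s) xs) (itWidth (histR R) xs) (histFn G R s xs) (j + 1) =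
      min (G (Fin.snoc (Fin.snoc (Fin.init xs) j)
        (seqEl (itBound (histR R) (histS s) xs) (itWidth (histR R) xs) (histFn G R s xs) j)))
        (R (Fin.init xs)) := by
  have h := (isItSeq_histFn hIk hG hR hs xs).2.2 j
    (hj.le.trans (mLen_sN_le (r := histR R) (sN := histS s) xs)) hj
  simpa [histStep, Fin.init_snoc, Fin.snoc_castSucc, Fin.snoc_last] using h

end Hist

/-! ## Comprehension along a length (`collectFn`) -/

section Collect

variable {k n : ℕ}

/-- The length parameter with one more bit: `|2·s + 1| = |s| + 1`. [folklore] -/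
def succLen (s : (Fin n → M) → M) (x : Fin n → M) : M := 2 * s x + 1

omit hI in
/-- `succLen` is a term function. [folklore] -/
theorem isTermFn_succLen {s : (Fin n → M) → M} (hs : IsTermFn s) : IsTermFn (succLen s) :=
  isTermFn_add_one (isTermFn_two_mul hs)

omit hI in
/-- `|succLen s x̄| = |s x̄| + 1`. [folklore] -/
theorem mLen_succLen (s : (Fin n → M) → M) (x : Fin n → M) : mLen (succLen s x) = mLen (s x) + 1 :=
  mLen_two_mul_add_one _

/-- **`collectFn F R s x̄`**: the code of the sequence `0, min (F(x̄,0)) (R x̄), …,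
min (F(x̄,|s x̄|)) (R x̄)` (comprehension of `F` along `z ≤ |s x̄|`, values truncated at `R x̄`):
the iteration with history of the step `(x̄, j, u) ↦ F(x̄, j)` from `u₀ = 0`.
[cite: BussContempMath1990, Thm. 11(b)] -/
noncomputable def collectFn (F : (Fin (n + 1) → M) → M) (R s : (Fin n → M) → M) (x : Fin n → M) : M :=
  histFn (fun v : Fin (n + 2) → M => F (Fin.init v)) R (succLen s) (Fin.snoc x 0)

/-- The length bound under which the digits of `collectFn` are taken. [folklore] -/
def collectBound (R s : (Fin n → M) → M) (x : Fin n → M) : M :=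
  itBound (histR R) (histS (succLen s)) (Fin.snoc x (0 : M))

/-- The digit width of `collectFn`: `|R x̄|`. [folklore] -/
def collectWidth (R : (Fin n → M) → M) (x : Fin n → M) : M := itWidth (histR R) (Fin.snoc x (0 : M))

omit hI in
/-- `collectWidth R x̄ = |R x̄|`. [folklore] -/
theorem collectWidth_eq (R : (Fin n → M) → M) (x : Fin n → M) : collectWidth R x = mLen (R x) := by
  simp [collectWidth, itWidth, histR]

omit hI in
/-- `collectBound R s x̄ = (2·(2 s x̄ + 1) + 1) # (2·R x̄ + 1)`. [folklore] -/
theorem collectBound_eq (R s : (Fin n → M) → M) (x : Fin n → M) :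
    collectBound R s x = mSmash (2 * (2 * s x + 1) + 1) (2 * R x + 1) := by
  simp [collectBound, itBound, histR, histS, succLen]

/-- **Comprehension**: if `F` is query-presentable and `R, s` are term functions then
`collectFn F R s` is query-presentable. [cite: BussContempMath1990, Thm. 11(b)] -/
theorem IsQFn.collectFn (hIk : M ⊨ INDScheme (sigmabFormulas (k + 1))) {F : (Fin (n + 1) → M) → M}
    (hF : IsQFn k F) {R s : (Fin n → M) → M} (hR : IsTermFn R) (hs : IsTermFn s) :
    IsQFn k (collectFn F R s) := by
  have hG : IsQFn k fun v : Fin (n + 2) → M => F (Fin.init v) := hF.relabel Fin.castSucc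
  have h := (hG.histFn hIk hR (isTermFn_succLen hs)).comp₁ hIk (isTermFn_zero (m := n)).isQFn
  exact h.of_eq fun x => rfl

/-- **Digits of the comprehension**: digit `z + 1` of `collectFn F R s x̄` is
`min (F(x̄, z)) (R x̄)` for `z ≤ |s x̄|` (and digit `0` is `0`). [cite: BussContempMath1990, Thm. 11(b)] -/
theorem seqEl_collectFn_succ (hIk : M ⊨ INDScheme (sigmabFormulas (k + 1)))
    {F : (Fin (n + 1) → M) → M} (hF : IsQFn k F) {R s : (Fin n → M) → M} (hR : IsTermFn R)
    (hs : IsTermFn s) (x : Fin n → M) {z : M} (hz : z ≤ mLen (s x)) :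
    seqEl (collectBound R s x) (collectWidth R x) (collectFn F R s x) (z + 1) =
      min (F (Fin.snoc x z)) (R x) := by
  have hG : IsQFn k fun v : Fin (n + 2) → M => F (Fin.init v) := hF.relabel Fin.castSucc
  have hz' : z < histLen (succLen s) (Fin.snoc x (0 : M)) := by
    simp only [histLen, Fin.init_snoc, mLen_succLen]
    exact (lt_add_one_iff' _ _).2 hz
  have h := seqEl_histFn_succ hIk hG hR (isTermFn_succLen hs) (Fin.snoc x 0) hz'
  simpa [collectFn, collectBound, collectWidth] using h

/-- Digit `0` of the comprehension is `0`. [folklore] -/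
theorem seqEl_collectFn_zero (hIk : M ⊨ INDScheme (sigmabFormulas (k + 1)))
    {F : (Fin (n + 1) → M) → M} (hF : IsQFn k F) {R s : (Fin n → M) → M} (hR : IsTermFn R)
    (hs : IsTermFn s) (x : Fin n → M) :
    seqEl (collectBound R s x) (collectWidth R x) (collectFn F R s x) 0 = 0 := by
  have hG : IsQFn k fun v : Fin (n + 2) → M => F (Fin.init v) := hF.relabel Fin.castSucc
  have h := seqEl_histFn_zero hIk hG hR (isTermFn_succLen hs) (Fin.snoc x 0)
  simpa [collectFn, collectBound, collectWidth] using h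

/-- The comprehension code is small: `< 2^{(|s|+2)·|R|}` under `collectBound`. [folklore] -/
theorem collectFn_lt (hIk : M ⊨ INDScheme (sigmabFormulas (k + 1)))
    {F : (Fin (n + 1) → M) → M} (hF : IsQFn k F) {R s : (Fin n → M) → M} (hR : IsTermFn R)
    (hs : IsTermFn s) (x : Fin n → M) :
    collectFn F R s x < pow2B (collectBound R s x) ((mLen (s x) + 1 + 1) * collectWidth R x) := by
  have hG : IsQFn k fun v : Fin (n + 2) → M => F (Fin.init v) := hF.relabel Fin.castSucc
  have h := histFn_lt hIk hG hR (isTermFn_succLen hs) (Fin.snoc x 0)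
  simpa [collectFn, collectBound, collectWidth, histLen, mLen_succLen] using h

end Collect

/-! ## The least zero below a length (`lsearchFn`; Buss 1990, §4, proof of Thm. 17, third subcase) -/

section LSearch

variable {k n : ℕ}

omit hB hI in
/-- The tuple `(x̄, a, b)` with `b` the variable, coordinatewise a term function of `b`. [folklore] -/
theorem isTermFn_snoc_snoc_apply₁ (x : Fin n → M) (a : M) (j : Fin (n + 2)) :
    IsTermFn fun t : Fin 1 → M => (Fin.snoc (Fin.snoc x a : Fin (n + 1) → M) (t 0) : Fin (n + 2) → M) j := by
  cases j using Fin.lastCases with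
  | last => simpa using IsTermFn.proj (0 : Fin 1)
  | cast j =>
    cases j using Fin.lastCases with
    | last => simpa using IsTermFn.const (m := 1) a
    | cast j => simpa using IsTermFn.const (m := 1) (x j)


open scoped Classical in
/-- **`lsearchFn F s x̄`**: the least `z ≤ |s x̄|` with `F(x̄, z) = 0`, and `|s x̄| + 1` if there is
none (or no least one) (Buss 1990, §4, proof of Thm. 17, third subcase, p. 20: the sharply
bounded `μ`-operator; cf. Thm. 12). [cite: BussContempMath1990, §4, proof of Thm. 17, third subcase (p. 20)] -/
noncomputable def lsearchFn (F : (Fin (n + 1) → M) → M) (s : (Fin n → M) → M) (x : Fin n → M) : M :=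
  if h : ∃ z, (z ≤ mLen (s x) ∧ F (Fin.snoc x z) = 0) ∧
      ∀ z', z' < z → ¬(z' ≤ mLen (s x) ∧ F (Fin.snoc x z') = 0) then Classical.choose h
  else mLen (s x) + 1

/-- The zero-indicator code of `F` along `z ≤ |s x̄|`: the comprehension with values truncated at
`1` (digit `z + 1` is `0` iff `F(x̄, z) = 0`). [folklore] -/
noncomputable def zeroCode (F : (Fin (n + 1) → M) → M) (s : (Fin n → M) → M) (x : Fin n → M) : M :=
  collectFn F (fun _ => 1) s x

/-- The length bound for the zero-indicator code. [folklore] -/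
def zeroBound (s : (Fin n → M) → M) (x : Fin n → M) : M := collectBound (fun _ => (1 : M)) s x

omit hI in
/-- `zeroBound` is a term function. [folklore] -/
theorem isTermFn_zeroBound {s : (Fin n → M) → M} (hs : IsTermFn s) : IsTermFn (zeroBound s) := by
  refine ((isTermFn_add_one (isTermFn_two_mul (isTermFn_add_one (isTermFn_two_mul hs)))).smash
    (isTermFn_add_one (isTermFn_two_mul isTermFn_one))).of_eq fun x => ?_
  simp [zeroBound, collectBound_eq]

omit hI in
/-- The digit width for the zero-indicator code is `|1| = 1`. [folklore] -/
theorem collectWidth_one (x : Fin n → M) : collectWidth (fun _ : Fin n → M => (1 : M)) x = 1 := by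
  simp [collectWidth_eq]

/-- `min a 1 = 0 ↔ a = 0`. [folklore] -/
theorem min_one_eq_zero_iff (a : M) : min a 1 = 0 ↔ a = 0 := by
  constructor
  · intro h
    rcases le_total a 1 with ha | ha
    · rwa [min_eq_left ha] at h
    · rw [min_eq_right ha] at h
      exact (one_ne_zero h).elim
  · rintro rfl
    simp

/-- The digits of the zero-indicator code: digit `z + 1` is `0` iff `F(x̄, z) = 0` (`z ≤ |s x̄|`).
[folklore] -/
theorem seqEl_zeroCode_eq_zero_iff (hIk : M ⊨ INDScheme (sigmabFormulas (k + 1)))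
    {F : (Fin (n + 1) → M) → M} (hF : IsQFn k F) {s : (Fin n → M) → M} (hs : IsTermFn s)
    (x : Fin n → M) {z : M} (hz : z ≤ mLen (s x)) :
    seqEl (zeroBound s x) 1 (zeroCode F s x) (z + 1) = 0 ↔ F (Fin.snoc x z) = 0 := by
  have h := seqEl_collectFn_succ hIk hF (R := fun _ => 1) isTermFn_one hs x hz
  rw [collectWidth_one] at h
  rw [zeroBound, zeroCode, h]
  exact min_one_eq_zero_iff _

/-- The predicate "digit `z + 1` of `H` (width `1`, under `zeroBound`) vanishes and `z ≤ |s x̄|`"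
is `Σᵇ₁`-definable in `(x̄, H, z)`. [folklore] -/
theorem isSigmabDef_zeroDigit {s : (Fin n → M) → M} (hs : IsTermFn s) :
    IsSigmabDef 1 fun u : Fin (n + 2) → M =>
      u (Fin.last (n + 1)) ≤ mLen (s (Fin.init (Fin.init u))) ∧
        seqEl (zeroBound s (Fin.init (Fin.init u))) 1 (u (Fin.last n).castSucc)
          (u (Fin.last (n + 1)) + 1) = 0 := by
  have hB : IsTermFn fun u : Fin (n + 2) → M => zeroBound s (Fin.init (Fin.init u)) :=
    isTermFn_init_init (isTermFn_zeroBound hs)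
  have hEl : IsSigmabFn 1 fun u : Fin (n + 2) → M =>
      seqEl (zeroBound s (Fin.init (Fin.init u))) 1 (u (Fin.last n).castSucc) (u (Fin.last (n + 1)) + 1) :=
    (isSigmabFn_seqEl.substAll (isTermFn_vec4 hB isTermFn_one (IsTermFn.proj (Fin.last n).castSucc)
      (isTermFn_add_one (IsTermFn.proj (Fin.last (n + 1)))))).of_eq fun _ => rfl
  refine (((isQFDef_le (IsTermFn.proj (Fin.last (n + 1))) (isTermFn_init_init hs).len).isSigmabDef 1).and
    (hEl.isDeltabDef_eq (isSigmabFn_of_isTermFn isTermFn_zero 1)).1).of_iff fun u => ?_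
  simp

open scoped Classical in
/-- `firstZeroFn s (x̄, H)`: the least `z ≤ |s x̄|` such that digit `z + 1` of `H` vanishes, and
`|s x̄| + 1` if there is none (the output function of `lsearchFn`). [folklore] -/
noncomputable def firstZeroFn (s : (Fin n → M) → M) (xs : Fin (n + 1) → M) : M :=
  if h : ∃ z, (z ≤ mLen (s (Fin.init xs)) ∧ seqEl (zeroBound s (Fin.init xs)) 1 (xs (Fin.last n)) (z + 1) = 0) ∧
      ∀ z', z' < z → ¬(z' ≤ mLen (s (Fin.init xs)) ∧
        seqEl (zeroBound s (Fin.init xs)) 1 (xs (Fin.last n)) (z' + 1) = 0)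
    then Classical.choose h else mLen (s (Fin.init xs)) + 1

/-- If some digit `z + 1 ≤ |s x̄| + 1` vanishes then there is a least such `z` (`Σᵇ₁` least-number
principle). [folklore] -/
theorem exists_least_zeroDigit {s : (Fin n → M) → M} (hs : IsTermFn s) (x : Fin n → M) (H : M)
    {z : M} (hz : z ≤ mLen (s x) ∧ seqEl (zeroBound s x) 1 H (z + 1) = 0) :
    ∃ z₀, (z₀ ≤ mLen (s x) ∧ seqEl (zeroBound s x) 1 H (z₀ + 1) = 0) ∧
      ∀ z', z' < z₀ → ¬(z' ≤ mLen (s x) ∧ seqEl (zeroBound s x) 1 H (z' + 1) = 0) := by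
  refine exists_least_of_sigmabDef (P := fun z => z ≤ mLen (s x) ∧ seqEl (zeroBound s x) 1 H (z + 1) = 0)
    ?_ hz
  refine ((isSigmabDef_zeroDigit hs).substAll (T := fun i (t : Fin 1 → M) =>
    (Fin.snoc (Fin.snoc x H : Fin (n + 1) → M) (t 0) : Fin (n + 2) → M) i)
    (isTermFn_snoc_snoc_apply₁ x H)).of_iff fun t => ?_
  simp

/-- The specification of `firstZeroFn`: either it is the least vanishing position, or there is
none and it is `|s x̄| + 1`. [folklore] -/
theorem firstZeroFn_spec {s : (Fin n → M) → M} (hs : IsTermFn s) (xs : Fin (n + 1) → M) :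
    ((firstZeroFn s xs ≤ mLen (s (Fin.init xs)) ∧
        seqEl (zeroBound s (Fin.init xs)) 1 (xs (Fin.last n)) (firstZeroFn s xs + 1) = 0) ∧
      ∀ z', z' < firstZeroFn s xs → ¬(z' ≤ mLen (s (Fin.init xs)) ∧
        seqEl (zeroBound s (Fin.init xs)) 1 (xs (Fin.last n)) (z' + 1) = 0)) ∨
    ((∀ z, ¬(z ≤ mLen (s (Fin.init xs)) ∧
        seqEl (zeroBound s (Fin.init xs)) 1 (xs (Fin.last n)) (z + 1) = 0)) ∧
      firstZeroFn s xs = mLen (s (Fin.init xs)) + 1) := by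
  unfold firstZeroFn
  split_ifs with h
  · exact Or.inl (Classical.choose_spec h)
  · refine Or.inr ⟨fun z hz => h (exists_least_zeroDigit hs _ _ hz), rfl⟩

/-- `firstZeroFn ≤ |s x̄| + 1`. [folklore] -/
theorem firstZeroFn_le {s : (Fin n → M) → M} (hs : IsTermFn s) (xs : Fin (n + 1) → M) :
    firstZeroFn s xs ≤ mLen (s (Fin.init xs)) + 1 := by
  rcases firstZeroFn_spec hs xs with ⟨⟨h1, -⟩, -⟩ | ⟨-, h⟩
  · exact h1.trans (le_add_right'' _ _)
  · exact h.le

/-- The graph of `firstZeroFn`: "`y` is the least vanishing position, or there is none and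
`y = |s x̄| + 1`" (the universal quantifiers are sharply bounded by `|s x̄|`). [folklore] -/
def FirstZeroGraph (s : (Fin n → M) → M) (x : Fin n → M) (H y : M) : Prop :=
  (y ≤ mLen (s x) ∧ seqEl (zeroBound s x) 1 H (y + 1) = 0 ∧
      ∀ z, z ≤ mLen (s x) → (z < y → ¬seqEl (zeroBound s x) 1 H (z + 1) = 0)) ∨
    (y = mLen (s x) + 1 ∧ ∀ z, z ≤ mLen (s x) → ¬seqEl (zeroBound s x) 1 H (z + 1) = 0)

/-- `firstZeroFn` satisfies its graph. [folklore] -/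
theorem firstZeroGraph_firstZeroFn {s : (Fin n → M) → M} (hs : IsTermFn s) (xs : Fin (n + 1) → M) :
    FirstZeroGraph s (Fin.init xs) (xs (Fin.last n)) (firstZeroFn s xs) := by
  rcases firstZeroFn_spec hs xs with ⟨⟨h1, h2⟩, h3⟩ | ⟨h1, h2⟩
  · exact Or.inl ⟨h1, h2, fun z hz hzy hD => h3 z hzy ⟨hz, hD⟩⟩
  · exact Or.inr ⟨h2, fun z hz hD => h1 z ⟨hz, hD⟩⟩

/-- The graph of `firstZeroFn` is functional. [folklore] -/
theorem FirstZeroGraph.eq {s : (Fin n → M) → M} (hs : IsTermFn s) {xs : Fin (n + 1) → M} {y : M}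
    (hy : FirstZeroGraph s (Fin.init xs) (xs (Fin.last n)) y) : y = firstZeroFn s xs := by
  have hf := firstZeroGraph_firstZeroFn hs xs
  set f := firstZeroFn s xs
  rcases hy with ⟨hy1, hy2, hy3⟩ | ⟨hy1, hy2⟩ <;> rcases hf with ⟨hf1, hf2, hf3⟩ | ⟨hf1, hf2⟩
  · exact le_antisymm (not_lt.1 fun h => hy3 f hf1 h hf2) (not_lt.1 fun h => hf3 y hy1 h hy2)
  · exact (hf2 y hy1 hy2).elim
  · exact (hy2 f hf1 hf2).elim
  · rw [hy1, hf1]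

/-- The graph of `firstZeroFn` is `Σᵇ₁`-definable in `(x̄, H, y)`. [folklore] -/
theorem isSigmabDef_firstZeroGraph {s : (Fin n → M) → M} (hs : IsTermFn s) :
    IsSigmabDef 1 fun v : Fin (n + 2) → M =>
      FirstZeroGraph s (Fin.init (Fin.init v)) (v (Fin.last n).castSucc) (v (Fin.last (n + 1))) := by
  -- the digit predicate on the context `(x̄, H, y, z)` : `Fin (n + 3)`
  have hB3 : IsTermFn fun u : Fin (n + 3) → M => zeroBound s (Fin.init (Fin.init (Fin.init u))) :=
    isTermFn_init3 (isTermFn_zeroBound hs)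
  have hDz : IsDeltabDef 1 fun u : Fin (n + 3) → M =>
      seqEl (zeroBound s (Fin.init (Fin.init (Fin.init u)))) 1 (u (Fin.last n).castSucc.castSucc)
        (u (Fin.last (n + 2)) + 1) = 0 :=
    ((isSigmabFn_seqEl.substAll (isTermFn_vec4 hB3 isTermFn_one
      (IsTermFn.proj (Fin.last n).castSucc.castSucc)
      (isTermFn_add_one (IsTermFn.proj (Fin.last (n + 2)))))).of_eq fun _ => rfl).isDeltabDef_eq
      (isSigmabFn_of_isTermFn isTermFn_zero 1)
  -- the digit predicate on the context `(x̄, H, y)` at `z := y`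
  have hB2 : IsTermFn fun v : Fin (n + 2) → M => zeroBound s (Fin.init (Fin.init v)) :=
    isTermFn_init_init (isTermFn_zeroBound hs)
  have hDy : IsDeltabDef 1 fun v : Fin (n + 2) → M =>
      seqEl (zeroBound s (Fin.init (Fin.init v))) 1 (v (Fin.last n).castSucc) (v (Fin.last (n + 1)) + 1) = 0 :=
    ((isSigmabFn_seqEl.substAll (isTermFn_vec4 hB2 isTermFn_one (IsTermFn.proj (Fin.last n).castSucc)
      (isTermFn_add_one (IsTermFn.proj (Fin.last (n + 1)))))).of_eq fun _ => rfl).isDeltabDef_eq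
      (isSigmabFn_of_isTermFn isTermFn_zero 1)
  have hℓ2 : IsTermFn fun v : Fin (n + 2) → M => mLen (s (Fin.init (Fin.init v))) :=
    (isTermFn_init_init hs).len
  -- `∀ z ≤ |s x̄| (z < y → ¬D z)` and `∀ z ≤ |s x̄| ¬D z`
  have hA1 : IsSigmabDef 1 fun v : Fin (n + 2) → M => ∀ z, z ≤ mLen (s (Fin.init (Fin.init v))) →
      (z < v (Fin.last (n + 1)) → ¬seqEl (zeroBound s (Fin.init (Fin.init v))) 1 (v (Fin.last n).castSucc)
        (z + 1) = 0) := by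
    refine (IsSigmabDef.ballLELen (i := 0)
      (R := fun u : Fin (n + 3) → M => u (Fin.last (n + 2)) < u (Fin.last (n + 1)).castSucc →
        ¬seqEl (zeroBound s (Fin.init (Fin.init (Fin.init u)))) 1 (u (Fin.last n).castSucc.castSucc)
          (u (Fin.last (n + 2)) + 1) = 0)
      (IsSigmabDef.imp ((isQFDef_lt (IsTermFn.proj (Fin.last (n + 2)))
        (IsTermFn.proj (Fin.last (n + 1)).castSucc)).isPibDef 1) hDz.not.1)
      ((isTermFn_init_init hs))).of_iff fun v => ?_
    simp [Fin.init_snoc, Fin.snoc_castSucc, Fin.snoc_last]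
  have hA2 : IsSigmabDef 1 fun v : Fin (n + 2) → M => ∀ z, z ≤ mLen (s (Fin.init (Fin.init v))) →
      ¬seqEl (zeroBound s (Fin.init (Fin.init v))) 1 (v (Fin.last n).castSucc) (z + 1) = 0 := by
    refine (IsSigmabDef.ballLELen (i := 0)
      (R := fun u : Fin (n + 3) → M =>
        ¬seqEl (zeroBound s (Fin.init (Fin.init (Fin.init u)))) 1 (u (Fin.last n).castSucc.castSucc)
          (u (Fin.last (n + 2)) + 1) = 0) hDz.not.1 (isTermFn_init_init hs)).of_iff fun v => ?_
    simp [Fin.init_snoc, Fin.snoc_castSucc, Fin.snoc_last]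
  refine ((((isQFDef_le (IsTermFn.proj (Fin.last (n + 1))) hℓ2).isSigmabDef 1).and
    (hDy.1.and hA1)).or (((isQFDef_eq (IsTermFn.proj (Fin.last (n + 1))) (isTermFn_add_one hℓ2)).isSigmabDef 1).and
      hA2)).of_iff fun v => ?_
  simp only [FirstZeroGraph]

/-- **`firstZeroFn` is `Σᵇ₁`-definable** (hence `Σᵇᵢ` for every `i ≥ 1`), bounded by
`|s x̄| + 1`. [folklore] -/
theorem isSigmabFn_firstZeroFn {s : (Fin n → M) → M} (hs : IsTermFn s) (i : ℕ) :
    IsSigmabFn (i + 1) (firstZeroFn s) := by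
  refine IsSigmabFn.mono (i := 1) ?_ (Nat.le_add_left 1 i)
  refine IsSigmabFn.of_unique (isSigmabDef_firstZeroGraph hs) (fun xs => ?_) (fun xs y hy => ?_)
    ⟨fun xs => mLen (s (Fin.init xs)) + 1, isTermFn_add_one (isTermFn_init hs).len, fun xs =>
      (mLe_iff _ _).2 (firstZeroFn_le hs xs)⟩
  · simpa using firstZeroGraph_firstZeroFn hs xs
  · simp only [Fin.init_snoc, Fin.snoc_castSucc, Fin.snoc_last] at hy
    exact FirstZeroGraph.eq hs (xs := xs) hy

/-- The zero-indicator code is query-presentable. [folklore] -/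
theorem IsQFn.zeroCode (hIk : M ⊨ INDScheme (sigmabFormulas (k + 1))) {F : (Fin (n + 1) → M) → M}
    (hF : IsQFn k F) {s : (Fin n → M) → M} (hs : IsTermFn s) : IsQFn k (zeroCode F s) :=
  hF.collectFn hIk isTermFn_one hs

/-- If `F(x̄, z) = 0` for some `z ≤ |s x̄|` then there is a least such `z` (via the zero-indicator
code and the `Σᵇ₁` least-number principle). [folklore] -/
theorem exists_least_zero (hIk : M ⊨ INDScheme (sigmabFormulas (k + 1))) {F : (Fin (n + 1) → M) → M}
    (hF : IsQFn k F) {s : (Fin n → M) → M} (hs : IsTermFn s) (x : Fin n → M) {z : M}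
    (hz : z ≤ mLen (s x) ∧ F (Fin.snoc x z) = 0) :
    ∃ z₀, (z₀ ≤ mLen (s x) ∧ F (Fin.snoc x z₀) = 0) ∧
      ∀ z', z' < z₀ → ¬(z' ≤ mLen (s x) ∧ F (Fin.snoc x z') = 0) := by
  have e : ∀ z, (z ≤ mLen (s x) ∧ F (Fin.snoc x z) = 0) ↔
      (z ≤ mLen (s x) ∧ seqEl (zeroBound s x) 1 (zeroCode F s x) (z + 1) = 0) := fun z =>
    ⟨fun h => ⟨h.1, (seqEl_zeroCode_eq_zero_iff hIk hF hs x h.1).2 h.2⟩,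
      fun h => ⟨h.1, (seqEl_zeroCode_eq_zero_iff hIk hF hs x h.1).1 h.2⟩⟩
  obtain ⟨z₀, h₀, h₁⟩ := exists_least_zeroDigit hs x (zeroCode F s x) ((e z).1 hz)
  exact ⟨z₀, (e z₀).2 h₀, fun z' hz' h => h₁ z' hz' ((e z').1 h)⟩

/-- The specification of `lsearchFn`: either it is the least zero `≤ |s x̄|`, or there is no
zero `≤ |s x̄|` and it is `|s x̄| + 1`. [cite: BussContempMath1990, §4, proof of Thm. 17, third subcase (p. 20)] -/
theorem lsearchFn_spec (hIk : M ⊨ INDScheme (sigmabFormulas (k + 1))) {F : (Fin (n + 1) → M) → M}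
    (hF : IsQFn k F) {s : (Fin n → M) → M} (hs : IsTermFn s) (x : Fin n → M) :
    ((lsearchFn F s x ≤ mLen (s x) ∧ F (Fin.snoc x (lsearchFn F s x)) = 0) ∧
        ∀ z', z' < lsearchFn F s x → ¬(z' ≤ mLen (s x) ∧ F (Fin.snoc x z') = 0)) ∨
      ((∀ z, ¬(z ≤ mLen (s x) ∧ F (Fin.snoc x z) = 0)) ∧ lsearchFn F s x = mLen (s x) + 1) := by
  unfold lsearchFn
  split_ifs with h
  · exact Or.inl (Classical.choose_spec h)
  · exact Or.inr ⟨fun z hz => h (exists_least_zero hIk hF hs x hz), rfl⟩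

/-- **`lsearchFn` is `firstZeroFn` of the zero-indicator code.** [folklore] -/
theorem lsearchFn_eq_firstZeroFn (hIk : M ⊨ INDScheme (sigmabFormulas (k + 1)))
    {F : (Fin (n + 1) → M) → M} (hF : IsQFn k F) {s : (Fin n → M) → M} (hs : IsTermFn s)
    (x : Fin n → M) : lsearchFn F s x = firstZeroFn s (Fin.snoc x (zeroCode F s x)) := by
  have e : ∀ z, z ≤ mLen (s x) → (F (Fin.snoc x z) = 0 ↔
      seqEl (zeroBound s x) 1 (zeroCode F s x) (z + 1) = 0) := fun z hz =>
    (seqEl_zeroCode_eq_zero_iff hIk hF hs x hz).symm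
  have hf := firstZeroFn_spec hs (Fin.snoc x (zeroCode F s x))
  simp only [Fin.init_snoc, Fin.snoc_last] at hf
  set f := firstZeroFn s (Fin.snoc x (zeroCode F s x))
  rcases lsearchFn_spec hIk hF hs x with ⟨⟨h1, h2⟩, h3⟩ | ⟨h1, h2⟩ <;>
    rcases hf with ⟨⟨hf1, hf2⟩, hf3⟩ | ⟨hf1, hf2⟩
  · exact le_antisymm (not_lt.1 fun h => h3 _ h ⟨hf1, (e _ hf1).2 hf2⟩)
      (not_lt.1 fun h => hf3 _ h ⟨h1, (e _ h1).1 h2⟩)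
  · exact (hf1 _ ⟨h1, (e _ h1).1 h2⟩).elim
  · exact (h1 _ ⟨hf1, (e _ hf1).2 hf2⟩).elim
  · rw [h2, hf2]

/-- **Sharply bounded search** (Buss 1990, §4, proof of Thm. 17, third subcase, p. 20: the
sharply bounded `μ`-operator is `Qᵢ`-defined "by limited iteration and Theorem 11"; semantically):
if `F` is query-presentable and `s` is a term function then `lsearchFn F s` — the least
`z ≤ |s x̄|` with `F(x̄, z) = 0` — is query-presentable. [cite: BussContempMath1990, §4, proof of Thm. 17, third subcase (p. 20)] -/
theorem IsQFn.lsearchFn (hIk : M ⊨ INDScheme (sigmabFormulas (k + 1))) {F : (Fin (n + 1) → M) → M}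
    (hF : IsQFn k F) {s : (Fin n → M) → M} (hs : IsTermFn s) : IsQFn k (lsearchFn F s) :=
  ((hF.zeroCode hIk hs).postcomp (isSigmabFn_firstZeroFn hs k)).of_eq fun x =>
    (lsearchFn_eq_firstZeroFn hIk hF hs x).symm

/-- `lsearchFn ≤ |s x̄| + 1`. [folklore] -/
theorem lsearchFn_le (hIk : M ⊨ INDScheme (sigmabFormulas (k + 1))) {F : (Fin (n + 1) → M) → M}
    (hF : IsQFn k F) {s : (Fin n → M) → M} (hs : IsTermFn s) (x : Fin n → M) :
    lsearchFn F s x ≤ mLen (s x) + 1 := by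
  rcases lsearchFn_spec hIk hF hs x with ⟨⟨h1, -⟩, -⟩ | ⟨-, h⟩
  · exact h1.trans (le_add_right'' _ _)
  · exact h.le

/-- If `lsearchFn ≤ |s x̄|` then it is a zero of `F(x̄, ·)`. [cite: BussContempMath1990, §4, proof of Thm. 17, third subcase (p. 20)] -/
theorem eq_zero_of_lsearchFn_le (hIk : M ⊨ INDScheme (sigmabFormulas (k + 1)))
    {F : (Fin (n + 1) → M) → M} (hF : IsQFn k F) {s : (Fin n → M) → M} (hs : IsTermFn s)
    {x : Fin n → M} (h : lsearchFn F s x ≤ mLen (s x)) : F (Fin.snoc x (lsearchFn F s x)) = 0 := by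
  rcases lsearchFn_spec hIk hF hs x with ⟨⟨-, h2⟩, -⟩ | ⟨-, h2⟩
  · exact h2
  · rw [h2] at h
    exact ((lt_add_one' _).not_ge h).elim

/-- Below `lsearchFn` there is no zero of `F(x̄, ·)` (`≤ |s x̄|`). [cite: BussContempMath1990, §4, proof of Thm. 17, third subcase (p. 20)] -/
theorem ne_zero_of_lt_lsearchFn (hIk : M ⊨ INDScheme (sigmabFormulas (k + 1)))
    {F : (Fin (n + 1) → M) → M} (hF : IsQFn k F) {s : (Fin n → M) → M} (hs : IsTermFn s)
    {x : Fin n → M} {z : M} (hz : z < lsearchFn F s x) (hzs : z ≤ mLen (s x)) :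
    F (Fin.snoc x z) ≠ 0 := by
  rcases lsearchFn_spec hIk hF hs x with ⟨-, h3⟩ | ⟨h1, -⟩
  · exact fun h => h3 z hz ⟨hzs, h⟩
  · exact fun h => h1 z ⟨hzs, h⟩

/-- `lsearchFn` is at most any zero `z ≤ |s x̄|` of `F(x̄, ·)`. [cite: BussContempMath1990, §4, proof of Thm. 17, third subcase (p. 20)] -/
theorem lsearchFn_le_of_eq_zero (hIk : M ⊨ INDScheme (sigmabFormulas (k + 1)))
    {F : (Fin (n + 1) → M) → M} (hF : IsQFn k F) {s : (Fin n → M) → M} (hs : IsTermFn s)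
    {x : Fin n → M} {z : M} (hzs : z ≤ mLen (s x)) (hz : F (Fin.snoc x z) = 0) :
    lsearchFn F s x ≤ z :=
  not_lt.1 fun h => ne_zero_of_lt_lsearchFn hIk hF hs h hzs hz

end LSearch

end BASICModel

end Literature.Computability.MetaComplexity
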